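import Mathlib.MeasureTheory.Integral.DivergenceTheorem
import Mathlib.Analysis.SpecialFunctions.SmoothTransition
import Mathlib.Analysis.Calculus.Deriv.Support
import Literature.Analysis.FluidPDE.LuoHouSeriesAnsatz
import HarnessLib

/-!
# Chae–Tsai 2015, Theorem 2 at the resonant exponent `γ = 2`: the cut-off argument, and the
# generalized Luo–Hou self-similar ansatz is trivial for EVERY `γ > 0`

Analysis/FluidPDE proof file (theorems only: no definitions, no named facts, no `sorry`), the
continuation of `LuoHouSeriesAnsatz.lean` (p563152: Chae–Tsai's Theorem 2 at finite order for
`γ ≠ 2`, whose docstring carries `TODO(general form)`: "`γ = 2` needs print's cut-off/`L^p`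
argument under (3.10)") and of `LuoHouSeriesAnsatzEngines.lean` (p561956: Engines A, A′, B).
This file supplies the third engine and closes that TODO.

## Source (held; `p.` = arXiv pages)

D. Chae, T.-P. Tsai, *Remark on Luo–Hou's ansatz for a self-similar solution to the 3D Euler
equations*, J. Nonlinear Sci. **25** (2015) 193–202 = arXiv:1402.4560 [`ChaeTsai2015`], §3,
Theorem 2 and its proof, the case `γ = 2` (p. 6):

> We now consider the case `γ = 2`. Fix a smooth nonincreasing function `σ : [0,∞) → [0,∞)` so
> that `σ(t) = 1` for `0 ≤ t ≤ 1` and `σ(t) = 0` for `t ≥ 2`. Using `pU₀^{p−1}σ_ρ` as a test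
> function where `σ_ρ(Y) = σ(|Y|/ρ)` and `ρ > 1`, and denoting `𝒟_ρ = 𝒟 ∩ B_{3ρ}(0)`, we get
> `0 = −∫_{𝒟_ρ} {(γY + ∇⊥Ψ₀)·∇U₀} pU₀^{p−1}σ_ρ = −∫_{𝒟_ρ} σ_ρ(γY + ∇⊥Ψ₀)·∇U₀^p
> = ∫_{𝒟_ρ} U₀^p ∇·{σ_ρ(γY + ∇⊥Ψ₀)} − ∫_{∂𝒟_ρ} U₀^p σ_ρ(γY + ∇⊥Ψ₀)·ν`. […] on `∂𝒟 ∩ B_{3ρ}`,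
> `ν = (1,0)` and `(γY + ∇⊥Ψ₀)·ν = γR − ∂_ZΨ₀ = 0` by assumption (Psi-BC) again. Thus the boundary
> integral vanishes. Also note `∇·[σ_ρ(γY + ∇⊥Ψ₀)] = 2γσ_ρ + ∇σ_ρ·(γY + ∇⊥Ψ₀)`. We conclude
> `2γ∫_𝒟 U₀^pσ_ρ = −∫_𝒟 U₀^p∇σ_ρ·(γY + ∇⊥Ψ₀) ≤ C∫_{ρ<|Y|<2ρ} U₀^p(1 + ρ⁻¹|∇Ψ₀|)`. By
> assumptions (UOPsi-infty) and (3.10), the last integral vanishes as `ρ → ∞`. We conclude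
> `U₀ ≡ 0`.

with Theorem 2's hypothesis (p. 5)

> (3.10) `lim_{ρ→∞} ∫_{ρ<|Y|<2ρ} (U_k^p + Ω_k^p) dY = 0` for all `k ≤ 1/γ`, for some even integer `p`.

## Contents

* `eq_zero_of_transport_wall_cutoff` — **Engine C**, the displayed argument as a lemma of real
  analysis: `U ∈ C¹`, `Ψ ∈ C²` on an open neighbourhood of `𝒟̄ = {R ≤ 0}`, `γ > 0`,
  `γY·∇U + ∇⊥Ψ·∇U = 0` on the open half-plane, `∂_ZΨ(0,·) = 0`, `|∇Ψ(Y)| = o(|Y|)`, and (3.10)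
  for `U` with an even `p` ⇒ `U ≡ 0` on `𝒟̄`. The test-function identity is Mathlib's divergence
  theorem on rectangles (`MeasureTheory.integral_divergence_prod_Icc_of_hasFDerivAt_off_countable_of_le`)
  for the field `σ_ρ U^p (γY + ∇⊥Ψ)` on `[−2ρ, 0] × [−2ρ, 2ρ]`: the wall face carries no flux by
  (Psi-BC), the three outer faces none by the cut-off; `∇·(γY + ∇⊥Ψ) = 2γ` by the symmetry of
  second derivatives (`ContDiffAt.isSymmSndFDerivAt`). The cut-off is the product
  `σ_ρ(R, Z) = η(R/ρ)η(Z/ρ)` of a one-dimensional plateau cut-off `η` built from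
  `Real.smoothTransition` inside the proof (`exists_cutoff_line`; no definition is introduced), so
  the "annulus" is the sup-norm annulus `{ρ < ‖Y‖ < 2ρ}` of `ℝ × ℝ`, the norm these files use.
* `chaeTsai2015_seriesAnsatz_trivial_of_integralDecay` — **Theorem 2 on `𝒞_{δ,T}`, finite order,
  for EVERY `γ > 0`**: the binders of `chaeTsai2015_seriesAnsatz_trivial` with `γ ≠ 2` replaced by
  "(3.10) for `U₀` if `γ = 2`", same conclusion (`U_k = Ω_k = 0`, `Ψ_k` constant on `𝒟̄`;
  `u₁ = ω₁ = 0`, `∇ψ₁ = 0` on `𝒞_{δ,T}`). Proof: `γ ≠ 2` is the tree theorem by name; at `γ = 2`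
  its induction on the order is re-run with Engine C at the resonant order `0` of the swirl
  equation — at `γ = 2` nothing else resonates (`1 − γ/2 − kγ = −2k`, `1 − kγ = 1 − 2k ≠ 0` for
  `k ≥ 1`), so every other step is Engine A or B of p561956 exactly as before.
* `chaeTsai2015_seriesAnsatz_trivial'` — the same with (3.10) for `U₀` assumed outright for a
  given even `p` (print's form of the hypothesis), every `γ > 0`.

## What is typed, and how it differs from print (disclosed; never silently stronger)

As in `LuoHouSeriesAnsatz.lean`: finitely many orders `k < N` (any `N`) instead of a formal
series (`TODO(general form)`); the region `𝒞_{δ,T}` only (the window `𝒲_{δ(t)}` is not typed);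
`U_k, Ω_k ∈ C¹`, `Ψ_k ∈ C²` on an open neighbourhood of the closed half-plane for print's
`C¹_loc(𝒟̄)`; the printed gap "`Ψ₀ = aR + b`. By (UOPsi-infty), `a = 0`" closed one order later
(see there). New here: hypothesis (3.10) is assumed for the leading swirl profile `U₀` ONLY, and
only when `γ = 2` — print assumes it for `U_k^p + Ω_k^p` and every `k ≤ 1/γ`, and uses it at every
resonant order; in the tree the resonances at orders `k ≥ 1` are settled by the ray argument
(Engine A′) without (3.10), and at `γ = 2` the vorticity coefficient `1 − 0·γ = 1` does not
resonate — so the typed hypothesis set is WEAKER than print's (the typed theorem implies the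
printed one on `𝒞_{δ,T}` at finite order). The annulus of (3.10) is the sup-norm annulus of
`ℝ × ℝ`; since `‖Y‖_∞ ≤ |Y| ≤ √2‖Y‖_∞`, each dyadic annulus of either norm is covered by two
consecutive dyadic annuli of the other, so for the nonnegative integrand `U₀^p` the two forms of
(3.10) are equivalent (this remark is not used in the proofs). Evenness of `p` is kept (it makes
`U₀^p ≥ 0`); `p = 0` is allowed but then (3.10) is unsatisfiable. The decay `U₀ = o(1)` is carried
(print assumes it) but not used at the resonant order.

## What this is NOT

Not a statement about Navier–Stokes and not a statement about Luo–Hou's or Chen–Hou's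
computations or about asymptotically self-similar blow-up: an EXACT finite-order generalized
self-similar expansion in the Luo–Hou gauge, imposed on a fixed neighbourhood of the ring together
with the wall condition, the stated decay and — at `γ = 2` — the integrability (3.10), is
compatible with the axisymmetric Euler equations only if it carries no swirl and no vorticity
there, for every `γ > 0` and every order.

## Mathlib / tree search

`lean search` (2026-08-27) for `integral_divergence_prod|ContDiffBump|smoothTransition|cut-off`
in `Literature/Analysis/FluidPDE`: no half-plane test-function/divergence lemma in the tree (the
Chae–Shvydkoy files assume their PDE in weak form); Mathlib has the divergence theorem on boxes
(`MeasureTheory.Integral.DivergenceTheorem`) and `Real.smoothTransition`, used here directly.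
Reused by name: `chaeTsai2015_seriesAnsatz_trivial`, `order_swirl`, `order_vorticity`,
`order_stream`, `series_substitution_at_scale` (p563152); `eq_zero_of_transport_wall_maxPrinciple`,
`eq_zero_of_rayTransport`, `stream_affine_of_wall_of_sublinearGradient` (p561956); `derivR`,
`derivZ`, `fderiv_apply_eq_derivR_derivZ`, `derivR_eq_deriv`, `contDiff_derivR` (`GeneralizedAxisymNS`).
The private half-plane helpers of the two earlier files are private there and are repeated.

## References

* D. Chae, T.-P. Tsai, J. Nonlinear Sci. 25 (2015) 193–202, doi:10.1007/s00332-014-9225-6,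
  arXiv:1402.4560: §3, Theorem 2, hypothesis (3.10) (arXiv p. 5) and the proof, case `γ = 2`
  (p. 6). [ChaeTsai2015]
* G. Luo, T. Y. Hou, arXiv:1310.0497, §4.7 (the numerics addressed; `γ ≈ 2.91`). [LuoHou2014]
* T. Y. Hou, arXiv:2405.10916, §2 (the `(u₁, ω₁, ψ₁)` variables = `GeneralizedAxisymNS`). [Hou2026]
-/

noncomputable section

open Set Function Filter MeasureTheory
open scoped Topology ContDiff

namespace Literature.Analysis.FluidPDE

namespace LuoHouSeries

/-! ### Generic lemma: a one-dimensional smooth plateau cut-off -/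

section Cutoff1

/-- **A smooth plateau cut-off on the line** built from Mathlib's `Real.smoothTransition`:
`η(x) = smoothTransition (2 − x) · smoothTransition (2 + x)` is `C^∞`, takes values in `[0, 1]`,
equals `1` on `[−1, 1]` and `0` outside `(−2, 2)`, and its derivative is bounded and vanishes
off the two transition layers `1 < |x| < 2`. [folklore] -/
private theorem exists_cutoff_line :
    ∃ η : ℝ → ℝ, ContDiff ℝ ∞ η ∧ (∀ x, 0 ≤ η x) ∧ (∀ x, η x ≤ 1) ∧
      (∀ x, |x| ≤ 1 → η x = 1) ∧ (∀ x, 2 ≤ |x| → η x = 0) ∧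
      (∀ x, deriv η x ≠ 0 → 1 < |x| ∧ |x| < 2) ∧
      ∃ C : ℝ, 0 ≤ C ∧ ∀ x, |deriv η x| ≤ C := by
  set η : ℝ → ℝ := fun x => Real.smoothTransition (2 - x) * Real.smoothTransition (2 + x) with hη
  have hsm : ContDiff ℝ ∞ η := by
    refine ContDiff.mul ?_ ?_
    · exact Real.smoothTransition.contDiff.comp (contDiff_const.sub contDiff_id)
    · exact Real.smoothTransition.contDiff.comp (contDiff_const.add contDiff_id)
  have h0 : ∀ x, 0 ≤ η x := fun x =>
    mul_nonneg (Real.smoothTransition.nonneg _) (Real.smoothTransition.nonneg _)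
  have h1 : ∀ x, η x ≤ 1 := fun x => by
    have a := Real.smoothTransition.le_one (2 - x)
    have b := Real.smoothTransition.le_one (2 + x)
    have a0 := Real.smoothTransition.nonneg (2 - x)
    calc η x = Real.smoothTransition (2 - x) * Real.smoothTransition (2 + x) := rfl
      _ ≤ 1 * 1 := mul_le_mul a b (Real.smoothTransition.nonneg _) zero_le_one
      _ = 1 := one_mul 1
  have hone : ∀ x, |x| ≤ 1 → η x = 1 := by
    intro x hx
    have hx' := abs_le.1 hx
    show Real.smoothTransition (2 - x) * Real.smoothTransition (2 + x) = 1
    rw [Real.smoothTransition.one_of_one_le (by linarith),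
      Real.smoothTransition.one_of_one_le (by linarith), one_mul]
  have hzero : ∀ x, 2 ≤ |x| → η x = 0 := by
    intro x hx
    show Real.smoothTransition (2 - x) * Real.smoothTransition (2 + x) = 0
    rcases le_abs'.1 hx with h | h
    · rw [Real.smoothTransition.zero_of_nonpos (show 2 + x ≤ 0 by linarith), mul_zero]
    · rw [Real.smoothTransition.zero_of_nonpos (show 2 - x ≤ 0 by linarith), zero_mul]
  -- the derivative vanishes off the transition layers
  have hlayer : ∀ x, deriv η x ≠ 0 → 1 < |x| ∧ |x| < 2 := by
    intro x hx
    by_contra hcon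
    apply hx
    rcases lt_trichotomy |x| 1 with hlt | heq | hgt
    · -- locally constant `1`
      have hev : η =ᶠ[𝓝 x] fun _ => (1 : ℝ) := by
        have ho : IsOpen {y : ℝ | |y| < 1} := isOpen_lt continuous_abs continuous_const
        filter_upwards [ho.mem_nhds hlt] with y hy
        exact hone y hy.le
      rw [hev.deriv_eq, deriv_const]
    · -- a maximum point
      have hmax : IsLocalMax η x :=
        Filter.Eventually.of_forall fun y => by rw [hone x heq.le]; exact h1 y
      exact hmax.deriv_eq_zero
    · rcases lt_trichotomy |x| 2 with hlt2 | heq2 | hgt2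
      · exact absurd ⟨hgt, hlt2⟩ hcon
      · -- a minimum point
        have hmin : IsLocalMin η x :=
          Filter.Eventually.of_forall fun y => by rw [hzero x heq2.ge]; exact h0 y
        exact hmin.deriv_eq_zero
      · -- locally constant `0`
        have hev : η =ᶠ[𝓝 x] fun _ => (0 : ℝ) := by
          have ho : IsOpen {y : ℝ | 2 < |y|} := isOpen_lt continuous_const continuous_abs
          filter_upwards [ho.mem_nhds hgt2] with y hy
          exact hzero y hy.le
        rw [hev.deriv_eq, deriv_const]
  -- the derivative is bounded (continuous with compact support)
  have hsupp : HasCompactSupport η := by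
    refine HasCompactSupport.intro (isCompact_Icc : IsCompact (Icc (-2 : ℝ) 2)) fun x hx => ?_
    apply hzero
    rw [mem_Icc, not_and_or, not_le, not_le] at hx
    rcases hx with h | h
    · rw [abs_of_neg (by linarith)]; linarith
    · rw [abs_of_pos (by linarith)]; linarith
  have hcont : Continuous (deriv η) := hsm.continuous_deriv (by simp)
  obtain ⟨C, hC⟩ := hcont.bounded_above_of_compact_support hsupp.deriv
  refine ⟨η, hsm, h0, h1, hone, hzero, hlayer, max C 0, le_max_right _ _, fun x => ?_⟩
  have := hC x
  rw [Real.norm_eq_abs] at this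
  exact this.trans (le_max_left _ _)

end Cutoff1

/-! ### Generic lemma: half-plane calculus in the `derivR`/`derivZ` vocabulary -/

section HalfPlaneCalculus3

variable {O : Set (ℝ × ℝ)} {G h : ℝ × ℝ → ℝ} {n : WithTop ℕ∞}

/-- Differentiability at points of an open set carrying a `Cⁿ` function, `n ≠ 0`. [folklore] -/
private theorem differentiableAt_of_contDiffOn_open (hG : ContDiffOn ℝ n G O) (hO : IsOpen O)
    (hn : n ≠ 0) {Y : ℝ × ℝ} (hY : Y ∈ O) : DifferentiableAt ℝ G Y :=
  (hG.differentiableOn hn).differentiableAt (hO.mem_nhds hY)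

/-- `∂_R` of a `C²` function is `C¹` on the open set. [folklore] -/
private theorem contDiffOn_derivR_open (hG : ContDiffOn ℝ 2 G O) (hO : IsOpen O) :
    ContDiffOn ℝ 1 (derivR G) O := by
  have h : ContDiffOn ℝ 1 (fderiv ℝ G) O := hG.fderiv_of_isOpen hO le_rfl
  have e : derivR G = fun q => fderiv ℝ G q (1, 0) := funext fun q => derivR_apply G q
  rw [e]
  exact h.clm_apply contDiffOn_const

/-- `∂_Z` of a `C²` function is `C¹` on the open set. [folklore] -/
private theorem contDiffOn_derivZ_open (hG : ContDiffOn ℝ 2 G O) (hO : IsOpen O) :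
    ContDiffOn ℝ 1 (derivZ G) O := by
  have h : ContDiffOn ℝ 1 (fderiv ℝ G) O := hG.fderiv_of_isOpen hO le_rfl
  have e : derivZ G = fun q => fderiv ℝ G q (0, 1) := funext fun q => derivZ_apply G q
  rw [e]
  exact h.clm_apply contDiffOn_const

/-- `∂_R` of a `C¹` function is continuous on the open set. [folklore] -/
private theorem continuousOn_derivR_open (hG : ContDiffOn ℝ 1 G O) (hO : IsOpen O) :
    ContinuousOn (derivR G) O := by
  have h : ContinuousOn (fderiv ℝ G) O := hG.continuousOn_fderiv_of_isOpen hO le_rfl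
  have e : derivR G = fun q => fderiv ℝ G q (1, 0) := funext fun q => derivR_apply G q
  rw [e]
  exact h.clm_apply continuousOn_const

/-- `∂_Z` of a `C¹` function is continuous on the open set. [folklore] -/
private theorem continuousOn_derivZ_open (hG : ContDiffOn ℝ 1 G O) (hO : IsOpen O) :
    ContinuousOn (derivZ G) O := by
  have h : ContinuousOn (fderiv ℝ G) O := hG.continuousOn_fderiv_of_isOpen hO le_rfl
  have e : derivZ G = fun q => fderiv ℝ G q (0, 1) := funext fun q => derivZ_apply G q
  rw [e]
  exact h.clm_apply continuousOn_const

/-- **Continuity extension to the wall.** A function continuous at a wall point `(0, Z)` and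
constant on the open half-plane takes that constant value at the wall point. [folklore] -/
private theorem eq_at_wall_of_eq_on_open {c : ℝ} {Z : ℝ} (hh : ContinuousAt h (0, Z))
    (hc : ∀ Y : ℝ × ℝ, Y.1 < 0 → h Y = c) : h (0, Z) = c := by
  have hcurve : Tendsto (fun r : ℝ => ((r, Z) : ℝ × ℝ)) (𝓝[<] 0) (𝓝 (0, Z)) := by
    have : Continuous fun r : ℝ => ((r, Z) : ℝ × ℝ) := continuous_id.prodMk continuous_const
    exact (this.tendsto' 0 (0, Z) rfl).mono_left nhdsWithin_le_nhds
  have h1 : Tendsto (fun r : ℝ => h (r, Z)) (𝓝[<] 0) (𝓝 (h (0, Z))) := hh.tendsto.comp hcurve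
  have h2 : Tendsto (fun r : ℝ => h (r, Z)) (𝓝[<] 0) (𝓝 c) := by
    refine tendsto_const_nhds.congr' ?_
    filter_upwards [self_mem_nhdsWithin] with r hr
    exact (hc (r, Z) hr).symm
  exact tendsto_nhds_unique h1 h2

/-- Product rule for `∂_R` at a point of differentiability. [folklore] -/
private theorem derivR_mul_pt {Y : ℝ × ℝ} (hG : DifferentiableAt ℝ G Y) (hh : DifferentiableAt ℝ h Y) :
    derivR (fun q => G q * h q) Y = derivR G Y * h Y + G Y * derivR h Y := by
  rw [derivR_apply, derivR_apply, derivR_apply, fderiv_fun_mul hG hh]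
  simp only [add_apply, FunLike.coe_smul, Pi.smul_apply, smul_eq_mul]
  ring

/-- Product rule for `∂_Z` at a point of differentiability. [folklore] -/
private theorem derivZ_mul_pt {Y : ℝ × ℝ} (hG : DifferentiableAt ℝ G Y) (hh : DifferentiableAt ℝ h Y) :
    derivZ (fun q => G q * h q) Y = derivZ G Y * h Y + G Y * derivZ h Y := by
  rw [derivZ_apply, derivZ_apply, derivZ_apply, fderiv_fun_mul hG hh]
  simp only [add_apply, FunLike.coe_smul, Pi.smul_apply, smul_eq_mul]
  ring

/-- Chain rule for a power: `∂_R (G^p) = p G^{p−1} ∂_R G`. [folklore] -/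
private theorem derivR_pow_pt {Y : ℝ × ℝ} (hG : DifferentiableAt ℝ G Y) (p : ℕ) :
    derivR (fun q => G q ^ p) Y = (p * G Y ^ (p - 1)) * derivR G Y := by
  have h : HasFDerivAt (fun q => G q ^ p) ((↑p * G Y ^ (p - 1)) • fderiv ℝ G Y) Y :=
    (hasDerivAt_pow p (G Y)).comp_hasFDerivAt Y hG.hasFDerivAt
  rw [derivR_apply, derivR_apply, h.fderiv]
  simp only [FunLike.coe_smul, Pi.smul_apply, smul_eq_mul]

/-- Chain rule for a power: `∂_Z (G^p) = p G^{p−1} ∂_Z G`. [folklore] -/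
private theorem derivZ_pow_pt {Y : ℝ × ℝ} (hG : DifferentiableAt ℝ G Y) (p : ℕ) :
    derivZ (fun q => G q ^ p) Y = (p * G Y ^ (p - 1)) * derivZ G Y := by
  have h : HasFDerivAt (fun q => G q ^ p) ((↑p * G Y ^ (p - 1)) • fderiv ℝ G Y) Y :=
    (hasDerivAt_pow p (G Y)).comp_hasFDerivAt Y hG.hasFDerivAt
  rw [derivZ_apply, derivZ_apply, h.fderiv]
  simp only [FunLike.coe_smul, Pi.smul_apply, smul_eq_mul]

/-- **Mixed partials commute** at points of an open set where the function is `C²`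
(Mathlib `ContDiffAt.isSymmSndFDerivAt`). [folklore] -/
private theorem derivR_derivZ_comm_pt (hG : ContDiffOn ℝ 2 G O) (hO : IsOpen O) {Y : ℝ × ℝ}
    (hY : Y ∈ O) : derivR (derivZ G) Y = derivZ (derivR G) Y := by
  have h2 : ContDiffAt ℝ 2 G Y := hG.contDiffAt (hO.mem_nhds hY)
  have hd : DifferentiableAt ℝ (fderiv ℝ G) Y :=
    (h2.fderiv_right (m := 1) (by norm_num)).differentiableAt one_ne_zero
  have eZ : derivZ G = fun y => fderiv ℝ G y (0, 1) := funext fun y => derivZ_apply G y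
  have eR : derivR G = fun y => fderiv ℝ G y (1, 0) := funext fun y => derivR_apply G y
  rw [derivR_apply, derivZ_apply (derivR G), eZ, eR,
    fderiv_clm_apply hd (differentiableAt_const _), fderiv_clm_apply hd (differentiableAt_const _)]
  simp only [fderiv_fun_const, Pi.zero_apply, ContinuousLinearMap.comp_zero, zero_add,
    ContinuousLinearMap.flip_apply]
  exact (h2.isSymmSndFDerivAt (by simp)) (1, 0) (0, 1)

/-- `∂_R (γR − ∂_ZΨ) = γ − ∂_R∂_ZΨ` at points of the open set. [folklore] -/
private theorem derivR_field₁ (hG : ContDiffOn ℝ 2 G O) (hO : IsOpen O) (γ : ℝ) {Y : ℝ × ℝ}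
    (hY : Y ∈ O) :
    derivR (fun q : ℝ × ℝ => γ * q.1 - derivZ G q) Y = γ - derivR (derivZ G) Y := by
  have h1 : DifferentiableAt ℝ (fun q : ℝ × ℝ => γ * q.1) Y := (differentiableAt_fst).const_mul γ
  have h2 : DifferentiableAt ℝ (derivZ G) Y :=
    differentiableAt_of_contDiffOn_open (contDiffOn_derivZ_open hG hO) hO one_ne_zero hY
  rw [derivR_apply, derivR_apply, fderiv_fun_sub h1 h2]
  simp only [FunLike.coe_sub, Pi.sub_apply]
  congr 1
  rw [fderiv_const_mul differentiableAt_fst, fderiv_fst]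
  simp

/-- `∂_Z (γZ + ∂_RΨ) = γ + ∂_Z∂_RΨ` at points of the open set. [folklore] -/
private theorem derivZ_field₂ (hG : ContDiffOn ℝ 2 G O) (hO : IsOpen O) (γ : ℝ) {Y : ℝ × ℝ}
    (hY : Y ∈ O) :
    derivZ (fun q : ℝ × ℝ => γ * q.2 + derivR G q) Y = γ + derivZ (derivR G) Y := by
  have h1 : DifferentiableAt ℝ (fun q : ℝ × ℝ => γ * q.2) Y := (differentiableAt_snd).const_mul γ
  have h2 : DifferentiableAt ℝ (derivR G) Y :=
    differentiableAt_of_contDiffOn_open (contDiffOn_derivR_open hG hO) hO one_ne_zero hY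
  rw [derivZ_apply, derivZ_apply, fderiv_fun_add h1 h2]
  simp only [FunLike.coe_add, Pi.add_apply]
  congr 1
  rw [fderiv_const_mul differentiableAt_snd, fderiv_snd]
  simp

end HalfPlaneCalculus3

/-! ### Generic lemma: the two-dimensional cut-off `σ_ρ(R, Z) = η(R/ρ) η(Z/ρ)` -/

section Cutoff2

variable {η : ℝ → ℝ}

/-- `∂_R σ_ρ = ρ⁻¹ η'(R/ρ) η(Z/ρ)`. [folklore] -/
private theorem derivR_cutoff (hsm : ContDiff ℝ ∞ η) (ρ : ℝ) (Y : ℝ × ℝ) :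
    derivR (fun q : ℝ × ℝ => η (q.1 / ρ) * η (q.2 / ρ)) Y =
      deriv η (Y.1 / ρ) / ρ * η (Y.2 / ρ) := by
  have hηd : Differentiable ℝ η := hsm.differentiable (by simp)
  have hf1 : DifferentiableAt ℝ (fun q : ℝ × ℝ => q.1 / ρ) Y := by
    simpa only [div_eq_mul_inv] using
      (differentiableAt_fst : DifferentiableAt ℝ (fun q : ℝ × ℝ => q.1) Y).mul_const ρ⁻¹
  have hf2 : DifferentiableAt ℝ (fun q : ℝ × ℝ => q.2 / ρ) Y := by
    simpa only [div_eq_mul_inv] using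
      (differentiableAt_snd : DifferentiableAt ℝ (fun q : ℝ × ℝ => q.2) Y).mul_const ρ⁻¹
  have h1 : DifferentiableAt ℝ (fun q : ℝ × ℝ => η (q.1 / ρ)) Y := (hηd _).comp Y hf1
  have h2 : DifferentiableAt ℝ (fun q : ℝ × ℝ => η (q.2 / ρ)) Y := (hηd _).comp Y hf2
  rw [derivR_mul_pt h1 h2]
  have e1 : derivR (fun q : ℝ × ℝ => η (q.1 / ρ)) Y = deriv η (Y.1 / ρ) / ρ := by
    rw [derivR_eq_deriv h1]
    have h : HasDerivAt (fun r : ℝ => η (r / ρ)) (deriv η (Y.1 / ρ) * (1 / ρ)) Y.1 :=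
      (hηd _).hasDerivAt.comp Y.1 ((hasDerivAt_id Y.1).div_const ρ)
    rw [h.deriv]; ring
  have e2 : derivR (fun q : ℝ × ℝ => η (q.2 / ρ)) Y = 0 := by
    rw [derivR_eq_deriv h2]
    exact deriv_const Y.1 (η (Y.2 / ρ))
  rw [e1, e2, mul_zero, add_zero]

/-- `∂_Z σ_ρ = ρ⁻¹ η(R/ρ) η'(Z/ρ)`. [folklore] -/
private theorem derivZ_cutoff (hsm : ContDiff ℝ ∞ η) (ρ : ℝ) (Y : ℝ × ℝ) :
    derivZ (fun q : ℝ × ℝ => η (q.1 / ρ) * η (q.2 / ρ)) Y =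
      η (Y.1 / ρ) * (deriv η (Y.2 / ρ) / ρ) := by
  have hηd : Differentiable ℝ η := hsm.differentiable (by simp)
  have hf1 : DifferentiableAt ℝ (fun q : ℝ × ℝ => q.1 / ρ) Y := by
    simpa only [div_eq_mul_inv] using
      (differentiableAt_fst : DifferentiableAt ℝ (fun q : ℝ × ℝ => q.1) Y).mul_const ρ⁻¹
  have hf2 : DifferentiableAt ℝ (fun q : ℝ × ℝ => q.2 / ρ) Y := by
    simpa only [div_eq_mul_inv] using
      (differentiableAt_snd : DifferentiableAt ℝ (fun q : ℝ × ℝ => q.2) Y).mul_const ρ⁻¹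
  have h1 : DifferentiableAt ℝ (fun q : ℝ × ℝ => η (q.1 / ρ)) Y := (hηd _).comp Y hf1
  have h2 : DifferentiableAt ℝ (fun q : ℝ × ℝ => η (q.2 / ρ)) Y := (hηd _).comp Y hf2
  rw [derivZ_mul_pt h1 h2]
  have e1 : derivZ (fun q : ℝ × ℝ => η (q.1 / ρ)) Y = 0 := by
    rw [derivZ_eq_deriv h1]
    exact deriv_const Y.2 (η (Y.1 / ρ))
  have e2 : derivZ (fun q : ℝ × ℝ => η (q.2 / ρ)) Y = deriv η (Y.2 / ρ) / ρ := by
    rw [derivZ_eq_deriv h2]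
    have h : HasDerivAt (fun z : ℝ => η (z / ρ)) (deriv η (Y.2 / ρ) * (1 / ρ)) Y.2 :=
      (hηd _).hasDerivAt.comp Y.2 ((hasDerivAt_id Y.2).div_const ρ)
    rw [h.deriv]; ring
  rw [e1, e2, zero_mul, zero_add]

end Cutoff2

/-! ### Engine C: the cut-off (`L^p`) argument at the resonant exponent -/

section CutoffEngine

variable {O : Set (ℝ × ℝ)}

/-- The transport expression extends by continuity from the open half-plane to the wall
(coefficient-free form). [folklore] -/
private theorem transport_eq_wall₀ (hO : IsOpen O) (hHO : {Y : ℝ × ℝ | Y.1 ≤ 0} ⊆ O)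
    {U Ψ : ℝ × ℝ → ℝ} {γ : ℝ} (hU : ContDiffOn ℝ 1 U O) (hΨ : ContDiffOn ℝ 2 Ψ O)
    (heq : ∀ Y : ℝ × ℝ, Y.1 < 0 → γ * (Y.1 * derivR U Y + Y.2 * derivZ U Y) +
      (-derivZ Ψ Y * derivR U Y + derivR Ψ Y * derivZ U Y) = 0) {Y : ℝ × ℝ} (hY : Y.1 ≤ 0) :
    γ * (Y.1 * derivR U Y + Y.2 * derivZ U Y) +
      (-derivZ Ψ Y * derivR U Y + derivR Ψ Y * derivZ U Y) = 0 := by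
  rcases hY.lt_or_eq with hlt | heq0
  · exact heq Y hlt
  · have eY : Y = (0, Y.2) := by ext <;> simp [heq0]
    have hYO : ((0 : ℝ), Y.2) ∈ O := hHO (show ((0 : ℝ), Y.2).1 ≤ 0 from le_rfl)
    have hn : O ∈ 𝓝 ((0 : ℝ), Y.2) := hO.mem_nhds hYO
    have cR : ContinuousAt (derivR U) (0, Y.2) := (continuousOn_derivR_open hU hO).continuousAt hn
    have cZ : ContinuousAt (derivZ U) (0, Y.2) := (continuousOn_derivZ_open hU hO).continuousAt hn
    have c1 : ContinuousAt (derivZ Ψ) (0, Y.2) :=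
      (contDiffOn_derivZ_open hΨ hO).continuousOn.continuousAt hn
    have c2 : ContinuousAt (derivR Ψ) (0, Y.2) :=
      (contDiffOn_derivR_open hΨ hO).continuousOn.continuousAt hn
    have cfst : ContinuousAt (fun q : ℝ × ℝ => q.1) (0, Y.2) := continuous_fst.continuousAt
    have csnd : ContinuousAt (fun q : ℝ × ℝ => q.2) (0, Y.2) := continuous_snd.continuousAt
    have hc : ContinuousAt (fun q : ℝ × ℝ => γ * (q.1 * derivR U q + q.2 * derivZ U q) +
        (-derivZ Ψ q * derivR U q + derivR Ψ q * derivZ U q)) (0, Y.2) :=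
      (continuousAt_const.mul ((cfst.mul cR).add (csnd.mul cZ))).add
        ((c1.neg.mul cR).add (c2.mul cZ))
    rw [eY]
    exact eq_at_wall_of_eq_on_open hc heq

/-- **Engine C (Chae–Tsai's cut-off argument at the resonant exponent).** Let `U ∈ C¹` and
`Ψ ∈ C²` on an open neighbourhood of the closed half-plane `𝒟̄ = {R ≤ 0}`, `γ > 0`, and suppose
the coefficient-free transport equation `γY·∇U + ∇⊥Ψ·∇U = 0` holds on the open half-plane,
the stream profile satisfies the wall condition `∂_ZΨ(0, ·) = 0` and has sub-linear gradient
`|∇Ψ(Y)| = o(|Y|)` on `𝒟̄`, and `U` satisfies Chae–Tsai's integrability condition (3.10)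
`lim_{ρ→∞} ∫_{𝒟̄ ∩ {ρ<‖Y‖<2ρ}} U^p dY = 0` for some even `p ≠ 0`. Then `U ≡ 0` on `𝒟̄`.
Print (p. 6): "Using `pU₀^{p−1}σ_ρ` as a test function […] on `∂𝒟 ∩ B_{3ρ}`, `ν = (1,0)` and
`(γY + ∇⊥Ψ₀)·ν = γR − ∂_ZΨ₀ = 0` by assumption (Psi-BC) again. Thus the boundary integral vanishes.
Also note `∇·[σ_ρ(γY + ∇⊥Ψ₀)] = 2γσ_ρ + ∇σ_ρ·(γY + ∇⊥Ψ₀)`. We conclude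
`2γ∫U₀^pσ_ρ = −∫U₀^p∇σ_ρ·(γY + ∇⊥Ψ₀) ≤ C∫_{ρ<|Y|<2ρ}U₀^p(1 + ρ⁻¹|∇Ψ₀|)`. By assumptions
(UOPsi-infty) and (3.10), the last integral vanishes as `ρ → ∞`. We conclude `U₀ ≡ 0`." Here the
test-function identity is Mathlib's divergence theorem on the rectangle `[−2ρ, 0] × [−2ρ, 2ρ]`
for the field `σ_ρ U^p (γY + ∇⊥Ψ)` (wall flux zero by (Psi-BC), outer faces zero by the cut-off),
`σ_ρ(R, Z) = η(R/ρ)η(Z/ρ)` with the plateau cut-off `η` of `exists_cutoff_line`; the annulus is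
the sup-norm annulus of `ℝ × ℝ` (equivalent to print's Euclidean one: each dyadic annulus of one
norm is covered by two consecutive dyadic annuli of the other). The decay `U = o(1)` is not needed.
[cite: ChaeTsai2015, §3, proof of Thm. 2, case γ = 2 (arXiv p. 6)] -/
theorem eq_zero_of_transport_wall_cutoff (hO : IsOpen O) (hHO : {Y : ℝ × ℝ | Y.1 ≤ 0} ⊆ O)
    {U Ψ : ℝ × ℝ → ℝ} {γ : ℝ} (hγ : 0 < γ) (hU : ContDiffOn ℝ 1 U O) (hΨ : ContDiffOn ℝ 2 Ψ O)
    (hwall : ∀ Z : ℝ, derivZ Ψ (0, Z) = 0)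
    (heq : ∀ Y : ℝ × ℝ, Y.1 < 0 → γ * (Y.1 * derivR U Y + Y.2 * derivZ U Y) +
      (-derivZ Ψ Y * derivR U Y + derivR Ψ Y * derivZ U Y) = 0)
    (hgrad : ∀ ε : ℝ, 0 < ε → ∃ M : ℝ, ∀ Y : ℝ × ℝ, Y.1 ≤ 0 → M ≤ ‖Y‖ →
      |derivR Ψ Y| + |derivZ Ψ Y| ≤ ε * ‖Y‖)
    {p : ℕ} (hp : Even p)
    (h310 : Tendsto (fun ρ : ℝ =>
      ∫ Y in {Y : ℝ × ℝ | Y.1 ≤ 0 ∧ ρ < ‖Y‖ ∧ ‖Y‖ < 2 * ρ}, U Y ^ p) atTop (𝓝 0)) :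
    ∀ Y : ℝ × ℝ, Y.1 ≤ 0 → U Y = 0 := by
  -- REGULARITY
  have hUc : ContinuousOn U O := hU.continuousOn
  have hUd : ∀ Y ∈ O, DifferentiableAt ℝ U Y :=
    fun Y hY => differentiableAt_of_contDiffOn_open hU hO one_ne_zero hY
  have hRΨ : ContDiffOn ℝ 1 (derivR Ψ) O := contDiffOn_derivR_open hΨ hO
  have hZΨ : ContDiffOn ℝ 1 (derivZ Ψ) O := contDiffOn_derivZ_open hΨ hO
  have hRΨd : ∀ Y ∈ O, DifferentiableAt ℝ (derivR Ψ) Y :=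
    fun Y hY => differentiableAt_of_contDiffOn_open hRΨ hO one_ne_zero hY
  have hZΨd : ∀ Y ∈ O, DifferentiableAt ℝ (derivZ Ψ) Y :=
    fun Y hY => differentiableAt_of_contDiffOn_open hZΨ hO one_ne_zero hY
  have hRUc : ContinuousOn (derivR U) O := continuousOn_derivR_open hU hO
  have hZUc : ContinuousOn (derivZ U) O := continuousOn_derivZ_open hU hO
  have heq' := fun (Y : ℝ × ℝ) (hY : Y.1 ≤ 0) => transport_eq_wall₀ hO hHO hU hΨ heq hY
  -- the power `W = U^p`
  set W : ℝ × ℝ → ℝ := fun Y => U Y ^ p with hW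
  have hW0 : ∀ Y, 0 ≤ W Y := fun Y => hp.pow_nonneg _
  have hWc : ContinuousOn W O := hUc.pow p
  have hWd : ∀ Y ∈ O, DifferentiableAt ℝ W Y := fun Y hY => (hUd Y hY).pow p
  -- REDUCTION to the open half-plane
  suffices hopen : ∀ Y : ℝ × ℝ, Y.1 < 0 → U Y = 0 by
    intro Y hY
    rcases hY.lt_or_eq with hlt | hwl
    · exact hopen Y hlt
    · have eY : Y = (0, Y.2) := by ext <;> simp [hwl]
      rw [eY]
      exact eq_at_wall_of_eq_on_open
        (hUc.continuousAt (hO.mem_nhds (hHO (show ((0 : ℝ), Y.2).1 ≤ 0 from le_rfl)))) hopen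
  -- CONTRADICTION HYPOTHESIS: a point of the open half-plane where `U ≠ 0`
  intro Y₀ hY₀
  by_contra hUY₀
  have hWY₀ : 0 < W Y₀ := hp.pow_pos hUY₀
  have hY₀O : Y₀ ∈ O := hHO hY₀.le
  -- a ball around `Y₀` inside the open half-plane where `W ≥ W(Y₀)/2`
  obtain ⟨r, hr, hball⟩ : ∃ r : ℝ, 0 < r ∧ ∀ Y ∈ Metric.closedBall Y₀ r,
      Y.1 < 0 ∧ W Y₀ / 2 ≤ W Y := by
    have hc : ContinuousAt W Y₀ := hWc.continuousAt (hO.mem_nhds hY₀O)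
    obtain ⟨δ, hδ, hδW⟩ := Metric.continuousAt_iff.1 hc (W Y₀ / 2) (half_pos hWY₀)
    refine ⟨min (δ / 2) (-Y₀.1 / 2), lt_min (half_pos hδ) (by linarith), fun Y hY => ?_⟩
    rw [Metric.mem_closedBall] at hY
    have h1 : dist Y Y₀ < δ := lt_of_le_of_lt (hY.trans (min_le_left _ _)) (half_lt_self hδ)
    have h2 : |Y.1 - Y₀.1| ≤ -Y₀.1 / 2 := by
      have := norm_fst_le (Y - Y₀)
      rw [Prod.fst_sub, Real.norm_eq_abs, ← dist_eq_norm] at this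
      exact this.trans (hY.trans (min_le_right _ _))
    refine ⟨by linarith [(abs_le.1 h2).2], ?_⟩
    have := hδW h1
    rw [Real.dist_eq] at this
    linarith [(abs_lt.1 this).1]
  set B : Set (ℝ × ℝ) := Metric.closedBall Y₀ r with hB
  have hBmeas : MeasurableSet B := Metric.isClosed_closedBall.measurableSet
  have hBfin : volume B ≠ ⊤ := (measure_closedBall_lt_top (μ := volume) (x := Y₀) (r := r)).ne
  have hBpos : 0 < volume.real B := by
    rw [measureReal_def]
    exact ENNReal.toReal_pos (Metric.measure_closedBall_pos volume Y₀ hr).ne' hBfin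
  set m : ℝ := W Y₀ / 2 * volume.real B with hm
  have hmpos : 0 < m := mul_pos (half_pos hWY₀) hBpos
  -- THE CUT-OFF and the sub-linear gradient scale
  obtain ⟨η, hηsm, hη0, hη1, hηone, hηzero, hηlayer, C, hC0, hC⟩ := exists_cutoff_line
  have hηc : Continuous η := hηsm.continuous
  have hηdc : Continuous (deriv η) := hηsm.continuous_deriv (by simp)
  have hηd0 : ∀ x, |x| ≤ 1 → deriv η x = 0 := fun x hx => by
    by_contra h; exact absurd (hηlayer x h).1 (not_lt.2 hx)
  have hηd2 : ∀ x, 2 ≤ |x| → deriv η x = 0 := fun x hx => by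
    by_contra h; exact absurd (hηlayer x h).2 (not_lt.2 hx)
  obtain ⟨M₁, hM₁⟩ := hgrad 1 one_pos
  set C₁ : ℝ := 4 * C * (γ + 1) + 1 with hC₁
  have hC₁pos : 0 < C₁ := by rw [hC₁]; positivity
  -- THE KEY ESTIMATE for every large `ρ`
  have key : ∀ ρ : ℝ, max (max M₁ (‖Y₀‖ + r)) 1 ≤ ρ →
      2 * γ * m ≤ C₁ * ∫ Y in {Y : ℝ × ℝ | Y.1 ≤ 0 ∧ ρ < ‖Y‖ ∧ ‖Y‖ < 2 * ρ}, W Y := by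
    intro ρ hρ
    have hρM : M₁ ≤ ρ := (le_max_left _ _).trans ((le_max_left _ _).trans hρ)
    have hρY : ‖Y₀‖ + r ≤ ρ := (le_max_right _ _).trans ((le_max_left _ _).trans hρ)
    have hρ1 : 1 ≤ ρ := (le_max_right _ _).trans hρ
    have hρ : 0 < ρ := lt_of_lt_of_le one_pos hρ1
    -- the cut-off `σ`, the field `V`, the fluxes `f, g` and the divergence `E`
    set σ : ℝ × ℝ → ℝ := fun q => η (q.1 / ρ) * η (q.2 / ρ) with hσ
    set V₁ : ℝ × ℝ → ℝ := fun q => γ * q.1 - derivZ Ψ q with hV₁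
    set V₂ : ℝ × ℝ → ℝ := fun q => γ * q.2 + derivR Ψ q with hV₂
    set f : ℝ × ℝ → ℝ := fun q => σ q * (V₁ q * W q) with hf
    set g : ℝ × ℝ → ℝ := fun q => σ q * (V₂ q * W q) with hg
    set E₂ : ℝ × ℝ → ℝ := fun q => W q * (derivR σ q * V₁ q + derivZ σ q * V₂ q) with hE₂
    set E : ℝ × ℝ → ℝ := fun q => 2 * γ * (σ q * W q) + E₂ q with hE
    set A : Set (ℝ × ℝ) := {Y : ℝ × ℝ | Y.1 ≤ 0 ∧ ρ < ‖Y‖ ∧ ‖Y‖ < 2 * ρ} with hA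
    set a : ℝ × ℝ := (-(2 * ρ), -(2 * ρ)) with ha
    set b : ℝ × ℝ := (0, 2 * ρ) with hb
    have hle : a ≤ b := Prod.mk_le_mk.2 ⟨by linarith, by linarith⟩
    have hKH : Icc a b ⊆ {Y : ℝ × ℝ | Y.1 ≤ 0} := fun Y hY => (Prod.le_def.1 hY.2).1
    have hKO : Icc a b ⊆ O := hKH.trans hHO
    have hKc : IsCompact (Icc a b) := isCompact_Icc
    -- smoothness of the cut-off
    have hσsm : ContDiff ℝ ∞ σ := by
      have h1 : ContDiff ℝ ∞ fun q : ℝ × ℝ => q.1 / ρ := by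
        simpa only [div_eq_mul_inv] using contDiff_fst.mul contDiff_const
      have h2 : ContDiff ℝ ∞ fun q : ℝ × ℝ => q.2 / ρ := by
        simpa only [div_eq_mul_inv] using contDiff_snd.mul contDiff_const
      exact (hηsm.comp h1).mul (hηsm.comp h2)
    have hσd : ∀ Y, DifferentiableAt ℝ σ Y := fun Y => (hσsm.differentiable (by simp)) Y
    have hσc : Continuous σ := hσsm.continuous
    have hσR : ∀ Y, derivR σ Y = deriv η (Y.1 / ρ) / ρ * η (Y.2 / ρ) :=
      fun Y => derivR_cutoff hηsm ρ Y
    have hσZ : ∀ Y, derivZ σ Y = η (Y.1 / ρ) * (deriv η (Y.2 / ρ) / ρ) :=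
      fun Y => derivZ_cutoff hηsm ρ Y
    have hσRc : Continuous (derivR σ) := (contDiff_derivR hσsm).continuous
    have hσZc : Continuous (derivZ σ) := (contDiff_derivZ hσsm).continuous
    have hσ0 : ∀ Y, 0 ≤ σ Y := fun Y => mul_nonneg (hη0 _) (hη0 _)
    have hσ1 : ∀ Y, σ Y ≤ 1 := fun Y => by
      calc σ Y = η (Y.1 / ρ) * η (Y.2 / ρ) := rfl
        _ ≤ 1 * 1 := mul_le_mul (hη1 _) (hη1 _) (hη0 _) zero_le_one
        _ = 1 := one_mul 1
    have habs_div : ∀ x : ℝ, |x / ρ| = |x| / ρ := fun x => by rw [abs_div, abs_of_pos hρ]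
    have hσone : ∀ Y : ℝ × ℝ, ‖Y‖ ≤ ρ → σ Y = 1 := by
      intro Y hY
      have h1 : |Y.1| ≤ ρ := by have := norm_fst_le Y; rw [Real.norm_eq_abs] at this; linarith
      have h2 : |Y.2| ≤ ρ := by have := norm_snd_le Y; rw [Real.norm_eq_abs] at this; linarith
      show η (Y.1 / ρ) * η (Y.2 / ρ) = 1
      rw [hηone _ (by rw [habs_div, div_le_one hρ]; exact h1),
        hηone _ (by rw [habs_div, div_le_one hρ]; exact h2), one_mul]
    have hσtwo₁ : ∀ Y : ℝ × ℝ, 2 * ρ ≤ |Y.1| → σ Y = 0 := by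
      intro Y hY
      show η (Y.1 / ρ) * η (Y.2 / ρ) = 0
      rw [hηzero (Y.1 / ρ) (by rw [habs_div, le_div_iff₀ hρ]; exact hY), zero_mul]
    have hσtwo₂ : ∀ Y : ℝ × ℝ, 2 * ρ ≤ |Y.2| → σ Y = 0 := by
      intro Y hY
      show η (Y.1 / ρ) * η (Y.2 / ρ) = 0
      rw [hηzero (Y.2 / ρ) (by rw [habs_div, le_div_iff₀ hρ]; exact hY), mul_zero]
    -- the gradient of the cut-off: bounded by `C/ρ`, supported in the annulus
    have hσRb : ∀ Y, |derivR σ Y| ≤ C / ρ := by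
      intro Y
      rw [hσR, abs_mul, abs_div, abs_of_pos hρ]
      calc |deriv η (Y.1 / ρ)| / ρ * |η (Y.2 / ρ)| ≤ C / ρ * 1 := by
            refine mul_le_mul (div_le_div_of_nonneg_right (hC _) hρ.le) ?_ (abs_nonneg _)
              (div_nonneg hC0 hρ.le)
            rw [abs_of_nonneg (hη0 _)]; exact hη1 _
        _ = C / ρ := mul_one _
    have hσZb : ∀ Y, |derivZ σ Y| ≤ C / ρ := by
      intro Y
      rw [hσZ, abs_mul, abs_div, abs_of_pos hρ]
      calc |η (Y.1 / ρ)| * (|deriv η (Y.2 / ρ)| / ρ) ≤ 1 * (C / ρ) := by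
            refine mul_le_mul ?_ (div_le_div_of_nonneg_right (hC _) hρ.le)
              (div_nonneg (abs_nonneg _) hρ.le) zero_le_one
            rw [abs_of_nonneg (hη0 _)]; exact hη1 _
        _ = C / ρ := one_mul _
    have hσgrad0 : ∀ Y : ℝ × ℝ, (‖Y‖ ≤ ρ ∨ 2 * ρ ≤ ‖Y‖) → derivR σ Y = 0 ∧ derivZ σ Y = 0 := by
      intro Y hY
      rcases hY with h | h
      · have h1 : |Y.1 / ρ| ≤ 1 := by
          rw [habs_div, div_le_one hρ]
          have := norm_fst_le Y; rw [Real.norm_eq_abs] at this; linarith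
        have h2 : |Y.2 / ρ| ≤ 1 := by
          rw [habs_div, div_le_one hρ]
          have := norm_snd_le Y; rw [Real.norm_eq_abs] at this; linarith
        rw [hσR, hσZ, hηd0 _ h1, hηd0 _ h2]; simp
      · rw [Prod.norm_def, Real.norm_eq_abs, Real.norm_eq_abs, le_max_iff] at h
        rcases h with h1 | h2
        · have h1' : 2 ≤ |Y.1 / ρ| := by rw [habs_div, le_div_iff₀ hρ]; exact h1
          rw [hσR, hσZ, hηd2 _ h1', hηzero _ h1']; simp
        · have h2' : 2 ≤ |Y.2 / ρ| := by rw [habs_div, le_div_iff₀ hρ]; exact h2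
          rw [hσR, hσZ, hηd2 _ h2', hηzero _ h2']; simp
    -- differentiability and continuity of the players on `O`
    have hV₁d : ∀ Y ∈ O, DifferentiableAt ℝ V₁ Y := fun Y hY =>
      ((differentiableAt_fst (𝕜 := ℝ)).const_mul γ).sub (hZΨd Y hY)
    have hV₂d : ∀ Y ∈ O, DifferentiableAt ℝ V₂ Y := fun Y hY =>
      ((differentiableAt_snd (𝕜 := ℝ)).const_mul γ).add (hRΨd Y hY)
    have hV₁c : ContinuousOn V₁ O :=
      ((continuous_fst.continuousOn).const_smul γ |>.congr (fun Y _ => by simp [smul_eq_mul])).sub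
        hZΨ.continuousOn |>.congr fun Y _ => rfl
    have hV₂c : ContinuousOn V₂ O :=
      ((continuous_snd.continuousOn).const_smul γ |>.congr (fun Y _ => by simp [smul_eq_mul])).add
        hRΨ.continuousOn |>.congr fun Y _ => rfl
    have hfd : ∀ Y ∈ O, DifferentiableAt ℝ f Y := fun Y hY =>
      (hσd Y).mul ((hV₁d Y hY).mul (hWd Y hY))
    have hgd : ∀ Y ∈ O, DifferentiableAt ℝ g Y := fun Y hY =>
      (hσd Y).mul ((hV₂d Y hY).mul (hWd Y hY))
    have hfc : ContinuousOn f O := hσc.continuousOn.mul (hV₁c.mul hWc)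
    have hgc : ContinuousOn g O := hσc.continuousOn.mul (hV₂c.mul hWc)
    have hE₂c : ContinuousOn E₂ O :=
      hWc.mul ((hσRc.continuousOn.mul hV₁c).add (hσZc.continuousOn.mul hV₂c))
    have hEc : ContinuousOn E O := (continuousOn_const.mul (hσc.continuousOn.mul hWc)).add hE₂c
    -- THE POINTWISE DIVERGENCE IDENTITY on the closed half-plane
    have hdiv : ∀ Y : ℝ × ℝ, Y.1 ≤ 0 → derivR f Y + derivZ g Y = E Y := by
      intro Y hY
      have hYO : Y ∈ O := hHO hY
      have e1 : derivR f Y = derivR σ Y * (V₁ Y * W Y) + σ Y * derivR (fun q => V₁ q * W q) Y :=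
        derivR_mul_pt (hσd Y) ((hV₁d Y hYO).mul (hWd Y hYO))
      have e2 : derivR (fun q => V₁ q * W q) Y = derivR V₁ Y * W Y + V₁ Y * derivR W Y :=
        derivR_mul_pt (hV₁d Y hYO) (hWd Y hYO)
      have e3 : derivR V₁ Y = γ - derivR (derivZ Ψ) Y := derivR_field₁ hΨ hO γ hYO
      have e4 : derivR W Y = (p * U Y ^ (p - 1)) * derivR U Y := derivR_pow_pt (hUd Y hYO) p
      have e5 : derivZ g Y = derivZ σ Y * (V₂ Y * W Y) + σ Y * derivZ (fun q => V₂ q * W q) Y :=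
        derivZ_mul_pt (hσd Y) ((hV₂d Y hYO).mul (hWd Y hYO))
      have e6 : derivZ (fun q => V₂ q * W q) Y = derivZ V₂ Y * W Y + V₂ Y * derivZ W Y :=
        derivZ_mul_pt (hV₂d Y hYO) (hWd Y hYO)
      have e7 : derivZ V₂ Y = γ + derivZ (derivR Ψ) Y := derivZ_field₂ hΨ hO γ hYO
      have e8 : derivZ W Y = (p * U Y ^ (p - 1)) * derivZ U Y := derivZ_pow_pt (hUd Y hYO) p
      have ecomm : derivR (derivZ Ψ) Y = derivZ (derivR Ψ) Y := derivR_derivZ_comm_pt hΨ hO hYO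
      have etr := heq' Y hY
      have hV₁Y : V₁ Y = γ * Y.1 - derivZ Ψ Y := rfl
      have hV₂Y : V₂ Y = γ * Y.2 + derivR Ψ Y := rfl
      rw [e1, e2, e3, e4, e5, e6, e7, e8]
      simp only [hE, hE₂]
      rw [hV₁Y, hV₂Y]
      linear_combination σ Y * W Y * ecomm.symm +
        σ Y * (↑p * U Y ^ (p - 1)) * etr
    -- THE DIVERGENCE THEOREM on `[−2ρ, 0] × [−2ρ, 2ρ]`: all four boundary fluxes vanish
    have hf_wall : ∀ y : ℝ, f (b.1, y) = 0 := by
      intro y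
      show σ (0, y) * ((γ * 0 - derivZ Ψ (0, y)) * W (0, y)) = 0
      rw [hwall y]; ring
    have hf_left : ∀ y : ℝ, f (a.1, y) = 0 := by
      intro y
      have : σ (-(2 * ρ), y) = 0 := hσtwo₁ _ (by
        show 2 * ρ ≤ |(-(2 * ρ))|; rw [abs_neg, abs_of_pos (by positivity)])
      show σ (-(2 * ρ), y) * _ = 0
      rw [this, zero_mul]
    have hg_top : ∀ x : ℝ, g (x, b.2) = 0 := by
      intro x
      have : σ (x, 2 * ρ) = 0 := hσtwo₂ _ (by
        show 2 * ρ ≤ |2 * ρ|; rw [abs_of_pos (by positivity)])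
      show σ (x, 2 * ρ) * _ = 0
      rw [this, zero_mul]
    have hg_bot : ∀ x : ℝ, g (x, a.2) = 0 := by
      intro x
      have : σ (x, -(2 * ρ)) = 0 := hσtwo₂ _ (by
        show 2 * ρ ≤ |(-(2 * ρ))|; rw [abs_neg, abs_of_pos (by positivity)])
      show σ (x, -(2 * ρ)) * _ = 0
      rw [this, zero_mul]
    have hEint : IntegrableOn E (Icc a b) := (hEc.mono hKO).integrableOn_compact hKc
    have hident : EqOn (fun x => fderiv ℝ f x (1, 0) + fderiv ℝ g x (0, 1)) E (Icc a b) :=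
      fun x hx => hdiv x (hKH hx)
    have Hi : IntegrableOn (fun x => fderiv ℝ f x (1, 0) + fderiv ℝ g x (0, 1)) (Icc a b) :=
      hEint.congr_fun hident.symm measurableSet_Icc
    have hDT := integral_divergence_prod_Icc_of_hasFDerivAt_off_countable_of_le f g
      (fun q => fderiv ℝ f q) (fun q => fderiv ℝ g q) a b hle ∅ countable_empty
      (hfc.mono hKO) (hgc.mono hKO)
      (fun x hx => (hfd x (hHO (le_of_lt (show x.1 < 0 from hx.1.1.2)))).hasFDerivAt)
      (fun x hx => (hgd x (hHO (le_of_lt (show x.1 < 0 from hx.1.1.2)))).hasFDerivAt) Hi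
    simp only [hf_wall, hf_left, hg_top, hg_bot, intervalIntegral.integral_zero, sub_zero,
      add_zero] at hDT
    have hE0 : ∫ x in Icc a b, E x = 0 := by
      rw [← setIntegral_congr_fun measurableSet_Icc hident]; exact hDT
    -- SPLIT the divergence integral
    have hE₁int : IntegrableOn (fun q => 2 * γ * (σ q * W q)) (Icc a b) :=
      ((continuousOn_const.mul (hσc.continuousOn.mul hWc)).mono hKO).integrableOn_compact hKc
    have hE₂int : IntegrableOn E₂ (Icc a b) := (hE₂c.mono hKO).integrableOn_compact hKc
    have hsplit : (∫ x in Icc a b, 2 * γ * (σ x * W x)) = -∫ x in Icc a b, E₂ x := by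
      have := integral_add hE₁int hE₂int
      rw [eq_neg_iff_add_eq_zero, ← this]
      exact hE0
    -- LOWER BOUND: the ball `B` lies in the box and carries `σ = 1`
    have hBK : B ⊆ Icc a b := by
      intro Y hY
      have hYn : ‖Y‖ ≤ ρ := by
        have h1 : ‖Y‖ ≤ ‖Y₀‖ + dist Y Y₀ := by
          have := norm_le_norm_add_norm_sub' Y Y₀
          rwa [← dist_eq_norm] at this
        linarith [Metric.mem_closedBall.1 hY]
      have h1 : |Y.1| ≤ ρ := by have := norm_fst_le Y; rw [Real.norm_eq_abs] at this; linarith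
      have h2 : |Y.2| ≤ ρ := by have := norm_snd_le Y; rw [Real.norm_eq_abs] at this; linarith
      refine ⟨Prod.mk_le_mk.2 ⟨?_, ?_⟩, Prod.le_def.2 ⟨(hball Y hY).1.le, ?_⟩⟩
      · linarith [(abs_le.1 h1).1]
      · linarith [(abs_le.1 h2).1]
      · show Y.2 ≤ 2 * ρ; linarith [(abs_le.1 h2).2]
    have hσW0 : ∀ Y, 0 ≤ σ Y * W Y := fun Y => mul_nonneg (hσ0 Y) (hW0 Y)
    have hlow : 2 * γ * m ≤ ∫ x in Icc a b, 2 * γ * (σ x * W x) := by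
      have hWintB : IntegrableOn W B := ((hWc.mono hKO).integrableOn_compact hKc).mono_set hBK
      have h1 : W Y₀ / 2 * volume.real B ≤ ∫ x in B, W x :=
        setIntegral_ge_of_const_le_real hBmeas hBfin (fun Y hY => (hball Y hY).2) hWintB
      have h2 : (∫ x in B, W x) = ∫ x in B, σ x * W x :=
        setIntegral_congr_fun hBmeas fun Y hY => by
          have hYn : ‖Y‖ ≤ ρ := by
            have h1 : ‖Y‖ ≤ ‖Y₀‖ + dist Y Y₀ := by
              have := norm_le_norm_add_norm_sub' Y Y₀
              rwa [← dist_eq_norm] at this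
            linarith [Metric.mem_closedBall.1 hY]
          show W Y = σ Y * W Y
          rw [hσone Y hYn, one_mul]
      have h3 : (∫ x in B, σ x * W x) ≤ ∫ x in Icc a b, σ x * W x :=
        setIntegral_mono_set (((hσc.continuousOn.mul hWc).mono hKO).integrableOn_compact hKc)
          (Eventually.of_forall fun Y => hσW0 Y) (Eventually.of_forall hBK)
      have h4 : (∫ x in Icc a b, 2 * γ * (σ x * W x)) = 2 * γ * ∫ x in Icc a b, σ x * W x :=
        integral_const_mul _ _
      rw [h4, hm]
      have hγ2 : 0 ≤ 2 * γ := by positivity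
      calc 2 * γ * (W Y₀ / 2 * volume.real B) ≤ 2 * γ * ∫ x in B, W x :=
            mul_le_mul_of_nonneg_left h1 hγ2
        _ = 2 * γ * ∫ x in B, σ x * W x := by rw [h2]
        _ ≤ 2 * γ * ∫ x in Icc a b, σ x * W x := mul_le_mul_of_nonneg_left h3 hγ2
    -- UPPER BOUND: the remainder lives on the annulus and is `≤ C₁ U^p` there
    have hAK : A ⊆ Icc a b := by
      intro Y hY
      obtain ⟨hY1, -, hY3⟩ := hY
      have h1 : |Y.1| < 2 * ρ := by
        have := norm_fst_le Y; rw [Real.norm_eq_abs] at this; linarith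
      have h2 : |Y.2| < 2 * ρ := by
        have := norm_snd_le Y; rw [Real.norm_eq_abs] at this; linarith
      refine ⟨Prod.mk_le_mk.2 ⟨?_, ?_⟩, Prod.le_def.2 ⟨hY1, ?_⟩⟩
      · linarith [(abs_lt.1 h1).1]
      · linarith [(abs_lt.1 h2).1]
      · show Y.2 ≤ 2 * ρ; linarith [(abs_lt.1 h2).2]
    have hAmeas : MeasurableSet A := by
      rw [hA, setOf_and, setOf_and]
      exact (measurableSet_le measurable_fst measurable_const).inter
        ((measurableSet_lt measurable_const measurable_norm).inter
          (measurableSet_lt measurable_norm measurable_const))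
    have hE₂zero : ∀ Y ∈ Icc a b \ A, |E₂ Y| = 0 := by
      intro Y hY
      have hY1 : Y.1 ≤ 0 := hKH hY.1
      have hYA : ‖Y‖ ≤ ρ ∨ 2 * ρ ≤ ‖Y‖ := by
        have h := hY.2
        rw [hA, mem_setOf_eq, not_and, not_and_or, not_lt, not_lt] at h
        exact h hY1
      obtain ⟨h1, h2⟩ := hσgrad0 Y hYA
      show |W Y * (derivR σ Y * V₁ Y + derivZ σ Y * V₂ Y)| = 0
      rw [h1, h2]; simp
    have hE₂bound : ∀ Y ∈ A, |E₂ Y| ≤ C₁ * W Y := by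
      intro Y hY
      obtain ⟨hY1, hY2, hY3⟩ := hY
      have hYM : M₁ ≤ ‖Y‖ := hρM.trans hY2.le
      have hg := hM₁ Y hY1 hYM
      rw [one_mul] at hg
      have hn1 : |Y.1| ≤ ‖Y‖ := by have := norm_fst_le Y; rwa [Real.norm_eq_abs] at this
      have hn2 : |Y.2| ≤ ‖Y‖ := by have := norm_snd_le Y; rwa [Real.norm_eq_abs] at this
      have hV₁b : |V₁ Y| ≤ (γ + 1) * (2 * ρ) := by
        calc |V₁ Y| = |γ * Y.1 - derivZ Ψ Y| := rfl
          _ ≤ |γ * Y.1| + |derivZ Ψ Y| := abs_sub _ _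
          _ = γ * |Y.1| + |derivZ Ψ Y| := by rw [abs_mul, abs_of_pos hγ]
          _ ≤ γ * ‖Y‖ + ‖Y‖ := by
              have := abs_nonneg (derivR Ψ Y); nlinarith
          _ = (γ + 1) * ‖Y‖ := by ring
          _ ≤ (γ + 1) * (2 * ρ) := by nlinarith
      have hV₂b : |V₂ Y| ≤ (γ + 1) * (2 * ρ) := by
        calc |V₂ Y| = |γ * Y.2 + derivR Ψ Y| := rfl
          _ ≤ |γ * Y.2| + |derivR Ψ Y| := abs_add_le _ _
          _ = γ * |Y.2| + |derivR Ψ Y| := by rw [abs_mul, abs_of_pos hγ]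
          _ ≤ γ * ‖Y‖ + ‖Y‖ := by
              have := abs_nonneg (derivZ Ψ Y); nlinarith
          _ = (γ + 1) * ‖Y‖ := by ring
          _ ≤ (γ + 1) * (2 * ρ) := by nlinarith
      have hsum : |derivR σ Y * V₁ Y + derivZ σ Y * V₂ Y| ≤ 4 * C * (γ + 1) := by
        calc |derivR σ Y * V₁ Y + derivZ σ Y * V₂ Y|
            ≤ |derivR σ Y * V₁ Y| + |derivZ σ Y * V₂ Y| := abs_add_le _ _
          _ = |derivR σ Y| * |V₁ Y| + |derivZ σ Y| * |V₂ Y| := by rw [abs_mul, abs_mul]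
          _ ≤ C / ρ * ((γ + 1) * (2 * ρ)) + C / ρ * ((γ + 1) * (2 * ρ)) := by
              gcongr
              · exact hσRb Y
              · exact hσZb Y
          _ = 4 * C * (γ + 1) := by field_simp; ring
      show |W Y * (derivR σ Y * V₁ Y + derivZ σ Y * V₂ Y)| ≤ C₁ * W Y
      rw [abs_mul, abs_of_nonneg (hW0 Y), mul_comm]
      refine mul_le_mul_of_nonneg_right (hsum.trans ?_) (hW0 Y)
      rw [hC₁]; linarith
    have hup : -(∫ x in Icc a b, E₂ x) ≤ C₁ * ∫ Y in A, W Y := by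
      have hWintA : IntegrableOn W A := ((hWc.mono hKO).integrableOn_compact hKc).mono_set hAK
      have habsint : IntegrableOn (fun x => |E₂ x|) (Icc a b) := hE₂int.abs
      calc -(∫ x in Icc a b, E₂ x) ≤ |∫ x in Icc a b, E₂ x| := neg_le_abs _
        _ ≤ ∫ x in Icc a b, |E₂ x| := abs_integral_le_integral_abs
        _ = ∫ x in A, |E₂ x| :=
            setIntegral_eq_of_subset_of_forall_sdiff_eq_zero measurableSet_Icc hAK hE₂zero
        _ ≤ ∫ x in A, C₁ * W x :=
            setIntegral_mono_on (habsint.mono_set hAK) (hWintA.const_mul C₁) hAmeas hE₂bound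
        _ = C₁ * ∫ x in A, W x := integral_const_mul _ _
    -- COMBINE
    calc 2 * γ * m ≤ ∫ x in Icc a b, 2 * γ * (σ x * W x) := hlow
      _ = -∫ x in Icc a b, E₂ x := hsplit
      _ ≤ C₁ * ∫ Y in A, W Y := hup
  -- THE LIMIT `ρ → ∞` contradicts the key estimate
  have hev : ∀ᶠ ρ : ℝ in atTop,
      (∫ Y in {Y : ℝ × ℝ | Y.1 ≤ 0 ∧ ρ < ‖Y‖ ∧ ‖Y‖ < 2 * ρ}, W Y) < 2 * γ * m / C₁ :=
    (tendsto_order.1 h310).2 _ (div_pos (by positivity) hC₁pos)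
  obtain ⟨ρ, hρ1, hρ2⟩ := (hev.and (eventually_ge_atTop (max (max M₁ (‖Y₀‖ + r)) 1))).exists
  have h1 := key ρ hρ2
  have h2 : C₁ * (∫ Y in {Y : ℝ × ℝ | Y.1 ≤ 0 ∧ ρ < ‖Y‖ ∧ ‖Y‖ < 2 * ρ}, W Y) < 2 * γ * m := by
    have := mul_lt_mul_of_pos_left hρ1 hC₁pos
    rwa [mul_div_cancel₀ _ hC₁pos.ne'] at this
  linarith

end CutoffEngine

/-! ### Chae–Tsai's Theorem 2 at every exponent `γ > 0` -/

section Main2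

open LuoHouAnsatz

variable {S : Set ℝ} {T γ δ : ℝ} {u₁ ω₁ ψ₁ : ℝ → ℝ × ℝ → ℝ} {U Ω Ψ : ℕ → ℝ × ℝ → ℝ}
  {O : Set (ℝ × ℝ)} {N : ℕ}

/-- `∂_R` only depends on the germ. [folklore] -/
private theorem derivR_congr_nhds {f g : ℝ × ℝ → ℝ} {Y : ℝ × ℝ} (h : f =ᶠ[𝓝 Y] g) :
    derivR f Y = derivR g Y := by
  rw [derivR_apply, h.fderiv_eq, derivR_apply]

/-- `∂_Z` only depends on the germ. [folklore] -/
private theorem derivZ_congr_nhds {f g : ℝ × ℝ → ℝ} {Y : ℝ × ℝ} (h : f =ᶠ[𝓝 Y] g) :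
    derivZ f Y = derivZ g Y := by
  rw [derivZ_apply, h.fderiv_eq, derivZ_apply]

/-- A `C¹` function on an open neighbourhood of the closed half-plane that vanishes on the closed
half-plane has vanishing partials there. [folklore] -/
private theorem derivR_derivZ_eq_zero_of_eq_zero (hO : IsOpen O) (hHO : {Y : ℝ × ℝ | Y.1 ≤ 0} ⊆ O)
    {G : ℝ × ℝ → ℝ} (hG : ContDiffOn ℝ 1 G O) (h0 : ∀ Y : ℝ × ℝ, Y.1 ≤ 0 → G Y = 0) {Y : ℝ × ℝ} (hY : Y.1 ≤ 0) :
    derivR G Y = 0 ∧ derivZ G Y = 0 := by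
  have hopen : ∀ Y' : ℝ × ℝ, Y'.1 < 0 → derivR G Y' = 0 ∧ derivZ G Y' = 0 := by
    intro Y' hY'
    have hev : G =ᶠ[𝓝 Y'] fun _ => (0 : ℝ) := by
      have ho : IsOpen {q : ℝ × ℝ | q.1 < 0} := isOpen_lt continuous_fst continuous_const
      filter_upwards [ho.mem_nhds hY'] with q hq
      exact h0 q hq.le
    rw [derivR_apply, derivZ_apply, hev.fderiv_eq]
    simp
  rcases hY.lt_or_eq with hlt | heq
  · exact hopen Y hlt
  · have hYO : Y ∈ O := hHO hY
    have hcR : ContinuousAt (derivR G) Y := (continuousOn_derivR_open hG hO).continuousAt (hO.mem_nhds hYO)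
    have hcZ : ContinuousAt (derivZ G) Y := (continuousOn_derivZ_open hG hO).continuousAt (hO.mem_nhds hYO)
    have eY : Y = (0, Y.2) := by ext <;> simp [heq]
    rw [eY] at hcR hcZ ⊢
    exact ⟨eq_at_wall_of_eq_on_open hcR fun Y' h => (hopen Y' h).1,
      eq_at_wall_of_eq_on_open hcZ fun Y' h => (hopen Y' h).2⟩


/-- The zero profile has vanishing partials of all orders used here. [folklore] -/
private theorem derivs_of_eq_zero {G : ℝ × ℝ → ℝ} (hG : G = 0) (Y : ℝ × ℝ) :
    G Y = 0 ∧ derivR G Y = 0 ∧ derivZ G Y = 0 ∧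
      derivR (derivR G) Y = 0 ∧ derivZ (derivZ G) Y = 0 := by
  have e : G = fun _ => (0 : ℝ) := hG
  subst e
  simp [derivR_const, derivZ_const]

/-- Admissible scales: every interior profile point is reached by all sufficiently small scales.
[folklore] -/
private theorem exists_scales (hγ : 0 < γ) (hδ : 0 < δ) (Y : ℝ × ℝ) :
    ∃ s₀ : ℝ, 0 < s₀ ∧ ∀ s ∈ Ioo 0 s₀,
      0 < s ∧ s ^ γ⁻¹ < δ ∧ s * |Y.1| < min δ 1 ∧ s * |Y.2| < δ := by
  set A : ℝ := |Y.1| + |Y.2| + 1 with hA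
  have hApos : 0 < A := by rw [hA]; positivity
  have hm : 0 < min δ 1 := lt_min hδ one_pos
  refine ⟨min (δ ^ γ) (min δ 1 / A), lt_min (Real.rpow_pos_of_pos hδ γ) (div_pos hm hApos),
    fun s hs => ?_⟩
  obtain ⟨hs0, hs1⟩ := hs
  have hsγ : s < δ ^ γ := lt_of_lt_of_le hs1 (min_le_left _ _)
  have hsA : s < min δ 1 / A := lt_of_lt_of_le hs1 (min_le_right _ _)
  have hsA' : s * A < min δ 1 := by rwa [lt_div_iff₀ hApos] at hsA
  refine ⟨hs0, ?_, ?_, ?_⟩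
  · have h := Real.rpow_lt_rpow hs0.le hsγ (inv_pos.2 hγ)
    rwa [← Real.rpow_mul hδ.le, mul_inv_cancel₀ hγ.ne', Real.rpow_one] at h
  · have : s * |Y.1| ≤ s * A := by
      apply mul_le_mul_of_nonneg_left _ hs0.le; rw [hA]; linarith [abs_nonneg Y.2]
    linarith
  · have : s * |Y.2| ≤ s * A := by
      apply mul_le_mul_of_nonneg_left _ hs0.le; rw [hA]; linarith [abs_nonneg Y.1]
    linarith [min_le_left δ 1]

/-- **Chae–Tsai 2015, Theorem 2 (generalized self-similar ansatz), finite order, EVERY `γ > 0`,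
on `𝒞_{δ,T}`.** Let `(u₁, ω₁, ψ₁)` solve the `(u₁, ω₁, ψ₁)`-form (01)–(03) of the axisymmetric
Euler equations (`GeneralizedAxisymNS S 3 0`) on `𝒞_{δ,T} = {1−δ < r < 1, |z| < δ, T−δ < t < T}`
and have there the representation (11k)–(13k)
`u₁ = (T−t)^{−1+γ/2} Σ_{k<N} (T−t)^{kγ} U_k(R,Z)`, `ω₁ = (T−t)^{−1} Σ_{k<N} (T−t)^{kγ} Ω_k(R,Z)`,
`ψ₁ = (T−t)^{−1+2γ} Σ_{k<N} (T−t)^{kγ} Ψ_k(R,Z)`, `R = (r−1)/(T−t)^γ`, `Z = z/(T−t)^γ`, with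
`0 < γ`, profiles `U_k, Ω_k ∈ C¹`, `Ψ_k ∈ C²` on an open neighbourhood of the closed half-plane
`𝒟̄ = {R ≤ 0}` (indexed by all `k`, zero from `N` on), the decay `|U_k(Y)| + |Ω_k(Y)| = o(1)`,
`|∇Ψ_k(Y)| = o(|Y|)` on `𝒟̄`, the wall condition `∂_ZΨ_k|_{R=0} = 0` (from `u^r = 0` at
`r = 1`), and — ONLY at the resonant exponent `γ = 2` — Chae–Tsai's integrability condition (3.10)
for the leading swirl profile: `lim_{ρ→∞} ∫_{𝒟̄ ∩ {ρ<‖Y‖<2ρ}} U₀^p = 0` for some even `p`. Then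
every `U_k`, `Ω_k` vanishes on `𝒟̄`, every `Ψ_k` is constant there, and consequently
`u₁ = ω₁ = 0` and `∇ψ₁ = 0` on `𝒞_{δ,T}`.
This is `chaeTsai2015_seriesAnsatz_trivial` (the case `γ ≠ 2`, used BY NAME) completed at the
single remaining resonance, `γ = 2` at order `0`, by Engine C (`eq_zero_of_transport_wall_cutoff`,
print's cut-off argument); at `γ = 2` no other order resonates (`1 − γ/2 − kγ = −2k`,
`1 − kγ = 1 − 2k` for `k ≥ 1`), so the orders `k ≥ 1` run on Engines A and B exactly as in the
`γ ≠ 2` file. Deviations from print, all disclosed: finitely many orders instead of a formal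
series; (3.10) is assumed for `U₀` only and only when `γ = 2` (print: for `U_k^p + Ω_k^p` and all
`k ≤ 1/γ`; every other resonance is settled by the ray argument of the `γ ≠ 2` file without it),
on the sup-norm annulus of `ℝ × ℝ` (equivalent to print's Euclidean annulus); `C¹/C²` on a
neighbourhood of `𝒟̄` for print's `C¹_loc(𝒟̄)`; print's step "`Ψ₀ = aR + b`. By (UOPsi-infty),
`a = 0`" replaced by the next-order stream equation (see `chaeTsai2015_seriesAnsatz_trivial`); the
window `𝒲_{δ(t)}` is not typed.
[cite: ChaeTsai2015, §3 Theorem 2 with (11k)–(13k), (UOPsi-infty), (Psi-BC), (3.10) (arXiv p. 5) and its proof incl. the case γ = 2 (p. 5–6)] -/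
theorem chaeTsai2015_seriesAnsatz_trivial_of_integralDecay (hγ : 0 < γ) (hδ : 0 < δ)
    (hS : Ioo (T - δ) T ⊆ S) (hO : IsOpen O) (hHO : {Y : ℝ × ℝ | Y.1 ≤ 0} ⊆ O)
    (hU : ∀ k, ContDiffOn ℝ 1 (U k) O) (hΩ : ∀ k, ContDiffOn ℝ 1 (Ω k) O)
    (hΨ : ∀ k, ContDiffOn ℝ 2 (Ψ k) O)
    (hN : ∀ k, N ≤ k → U k = 0 ∧ Ω k = 0 ∧ Ψ k = 0)
    (hE : ∀ t ∈ Ioo (T - δ) T, ∀ q : ℝ × ℝ, 1 - δ < q.1 → q.1 < 1 → |q.2| < δ →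
      GeneralizedAxisymNS S 3 0 u₁ ω₁ ψ₁ t q)
    (hu : ∀ t ∈ Ioo (T - δ) T, ∀ q : ℝ × ℝ, 1 - δ < q.1 → q.1 < 1 → |q.2| < δ →
      u₁ t q = (T - t) ^ (-1 + γ / 2) * ∑ k ∈ Finset.range N,
        ((T - t) ^ γ) ^ k * U k ((q.1 - 1) / (T - t) ^ γ, q.2 / (T - t) ^ γ))
    (hω : ∀ t ∈ Ioo (T - δ) T, ∀ q : ℝ × ℝ, 1 - δ < q.1 → q.1 < 1 → |q.2| < δ →
      ω₁ t q = (T - t)⁻¹ * ∑ k ∈ Finset.range N,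
        ((T - t) ^ γ) ^ k * Ω k ((q.1 - 1) / (T - t) ^ γ, q.2 / (T - t) ^ γ))
    (hψ : ∀ t ∈ Ioo (T - δ) T, ∀ q : ℝ × ℝ, 1 - δ < q.1 → q.1 < 1 → |q.2| < δ →
      ψ₁ t q = (T - t) ^ (-1 + 2 * γ) * ∑ k ∈ Finset.range N,
        ((T - t) ^ γ) ^ k * Ψ k ((q.1 - 1) / (T - t) ^ γ, q.2 / (T - t) ^ γ))
    (hdecay : ∀ k, ∀ ε : ℝ, 0 < ε → ∃ M : ℝ, ∀ Y : ℝ × ℝ, Y.1 ≤ 0 → M ≤ ‖Y‖ →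
      |U k Y| + |Ω k Y| < ε)
    (hgrad : ∀ k, ∀ ε : ℝ, 0 < ε → ∃ M : ℝ, ∀ Y : ℝ × ℝ, Y.1 ≤ 0 → M ≤ ‖Y‖ →
      |derivR (Ψ k) Y| + |derivZ (Ψ k) Y| ≤ ε * ‖Y‖)
    (hwall : ∀ k (Z : ℝ), derivZ (Ψ k) (0, Z) = 0)
    (h310 : γ = 2 → ∃ p : ℕ, Even p ∧ Tendsto (fun ρ : ℝ =>
      ∫ Y in {Y : ℝ × ℝ | Y.1 ≤ 0 ∧ ρ < ‖Y‖ ∧ ‖Y‖ < 2 * ρ}, U 0 Y ^ p) atTop (𝓝 0)) :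
    (∀ k, ∃ b : ℝ, ∀ Y : ℝ × ℝ, Y.1 ≤ 0 →
      U k Y = 0 ∧ Ω k Y = 0 ∧ Ψ k Y = b ∧ derivR (Ψ k) Y = 0 ∧ derivZ (Ψ k) Y = 0) ∧
    (∀ t ∈ Ioo (T - δ) T, ∀ q : ℝ × ℝ, 1 - δ < q.1 → q.1 < 1 → |q.2| < δ →
      u₁ t q = 0 ∧ ω₁ t q = 0 ∧ derivR (ψ₁ t) q = 0 ∧ derivZ (ψ₁ t) q = 0) := by
  -- the non-resonant exponents: the `γ ≠ 2` theorem by name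
  by_cases hγ2 : γ ≠ 2
  · exact chaeTsai2015_seriesAnsatz_trivial hγ hγ2 hδ hS hO hHO hU hΩ hΨ hN hE hu hω hψ hdecay
      hgrad hwall
  rw [not_ne_iff] at hγ2
  obtain ⟨p, hp, h310⟩ := h310 hγ2
  -- profiles beyond the order bound
  have zU : ∀ l, N ≤ l → ∀ Y : ℝ × ℝ, U l Y = 0 ∧ derivR (U l) Y = 0 ∧ derivZ (U l) Y = 0 :=
    fun l hl Y => let h := derivs_of_eq_zero (hN l hl).1 Y; ⟨h.1, h.2.1, h.2.2.1⟩
  have zΩ : ∀ l, N ≤ l → ∀ Y : ℝ × ℝ, Ω l Y = 0 ∧ derivR (Ω l) Y = 0 ∧ derivZ (Ω l) Y = 0 :=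
    fun l hl Y => let h := derivs_of_eq_zero (hN l hl).2.1 Y; ⟨h.1, h.2.1, h.2.2.1⟩
  have zΨ : ∀ l, N ≤ l → ∀ Y : ℝ × ℝ, Ψ l Y = 0 ∧ derivR (Ψ l) Y = 0 ∧ derivZ (Ψ l) Y = 0 :=
    fun l hl Y => let h := derivs_of_eq_zero (hN l hl).2.2 Y; ⟨h.1, h.2.1, h.2.2.1⟩
  have zΨ2 : ∀ l, N ≤ l → ∀ Y : ℝ × ℝ, derivR (Ψ l) Y = 0 ∧
      derivR (derivR (Ψ l)) Y + derivZ (derivZ (Ψ l)) Y = 0 :=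
    fun l hl Y => let h := derivs_of_eq_zero (hN l hl).2.2 Y; ⟨h.2.1, by rw [h.2.2.2.1, h.2.2.2.2, add_zero]⟩
  -- decay of the individual families
  have decU : ∀ k, ∀ ε : ℝ, 0 < ε → ∃ M : ℝ, ∀ Y : ℝ × ℝ, Y.1 ≤ 0 → M ≤ ‖Y‖ → |U k Y| < ε := by
    intro k ε hε
    obtain ⟨M, hM⟩ := hdecay k ε hε
    exact ⟨M, fun Y hY hM' => by have := hM Y hY hM'; linarith [abs_nonneg (Ω k Y)]⟩
  have decΩ : ∀ k, ∀ ε : ℝ, 0 < ε → ∃ M : ℝ, ∀ Y : ℝ × ℝ, Y.1 ≤ 0 → M ≤ ‖Y‖ → |Ω k Y| < ε := by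
    intro k ε hε
    obtain ⟨M, hM⟩ := hdecay k ε hε
    exact ⟨M, fun Y hY hM' => by have := hM Y hY hM'; linarith [abs_nonneg (U k Y)]⟩
  -- the generating identities at every interior profile point
  have hgen := fun (Y : ℝ × ℝ) (hY1 : Y.1 < 0) (s : ℝ) (hs : 0 < s) (h1 : s ^ γ⁻¹ < δ)
    (h2 : s * |Y.1| < min δ 1) (h3 : s * |Y.2| < δ) =>
    series_substitution_at_scale hγ hS hO hHO hU hΩ hΨ hE hu hω hψ hY1 hs h1 h2 h3
  -- the leading stream field `W = ∇⊥Ψ₀` of the maximum principle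
  have hW₁ : ContinuousOn (fun Y => -derivZ (Ψ 0) Y) O :=
    (continuousOn_derivZ_open ((hΨ 0).of_le one_le_two) hO).neg
  have hW₂ : ContinuousOn (derivR (Ψ 0)) O := continuousOn_derivR_open ((hΨ 0).of_le one_le_two) hO
  have hW₁wall : ∀ Z : ℝ, (fun Y => -derivZ (Ψ 0) Y) (0, Z) = 0 := fun Z => by
    simp only [hwall 0 Z, neg_zero]
  -- THE INDUCTION ON THE ORDER
  have main : ∀ k : ℕ, ∀ l, l < k →
      (∀ Y : ℝ × ℝ, Y.1 ≤ 0 → U l Y = 0 ∧ Ω l Y = 0) ∧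
      ∃ a b : ℝ, (∀ Y : ℝ × ℝ, Y.1 ≤ 0 →
        Ψ l Y = a * Y.1 + b ∧ derivR (Ψ l) Y = a ∧ derivZ (Ψ l) Y = 0) ∧ (l + 1 < k → a = 0) := by
    intro k
    induction k with
    | zero => intro l hl; exact absurd hl (Nat.not_lt_zero l)
    | succ k ih =>
      -- data below order `k`
      have hUl : ∀ l, l < k → ∀ Y : ℝ × ℝ, Y.1 ≤ 0 → U l Y = 0 :=
        fun l hl Y hY => ((ih l hl).1 Y hY).1
      have hΩl : ∀ l, l < k → ∀ Y : ℝ × ℝ, Y.1 ≤ 0 → Ω l Y = 0 :=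
        fun l hl Y hY => ((ih l hl).1 Y hY).2
      have vU : ∀ l, l < k → ∀ Y : ℝ × ℝ, Y.1 ≤ 0 →
          U l Y = 0 ∧ derivR (U l) Y = 0 ∧ derivZ (U l) Y = 0 := fun l hl Y hY =>
        ⟨hUl l hl Y hY, derivR_derivZ_eq_zero_of_eq_zero hO hHO (hU l) (hUl l hl) hY⟩
      have vΩ : ∀ l, l < k → ∀ Y : ℝ × ℝ, Y.1 ≤ 0 →
          Ω l Y = 0 ∧ derivR (Ω l) Y = 0 ∧ derivZ (Ω l) Y = 0 := fun l hl Y hY =>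
        ⟨hΩl l hl Y hY, derivR_derivZ_eq_zero_of_eq_zero hO hHO (hΩ l) (hΩl l hl) hY⟩
      -- at a resonant order `k ≥ 1` the leading stream profile is affine
      have hres : 0 < k →
          ∃ a₀ : ℝ, ∀ Y : ℝ × ℝ, Y.1 ≤ 0 → derivR (Ψ 0) Y = a₀ ∧ derivZ (Ψ 0) Y = 0 := by
        intro hk
        obtain ⟨_, a₀, b₀, hΨ0, _⟩ := ih 0 hk
        exact ⟨a₀, fun Y hY => ⟨(hΨ0 Y hY).2.1, (hΨ0 Y hY).2.2⟩⟩
      -- from an affine leading stream profile, the transport field is radial from a wall point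
      have hray : ∀ (G : ℝ × ℝ → ℝ) (a₀ : ℝ),
          (∀ Y : ℝ × ℝ, Y.1 ≤ 0 → derivR (Ψ 0) Y = a₀ ∧ derivZ (Ψ 0) Y = 0) →
          (∀ Y : ℝ × ℝ, Y.1 < 0 → (0 : ℝ) * G Y + γ * (Y.1 * derivR G Y + Y.2 * derivZ G Y) +
            (-derivZ (Ψ 0) Y * derivR G Y + derivR (Ψ 0) Y * derivZ G Y) = 0) →
          ∀ Y : ℝ × ℝ, Y.1 < 0 → Y.1 * derivR G Y + (Y.2 - (-a₀ / γ)) * derivZ G Y = 0 := by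
        intro G a₀ hΨ0 heq Y hY
        have e := heq Y hY
        rw [(hΨ0 Y hY.le).1, (hΨ0 Y hY.le).2] at e
        have h' : γ * (Y.1 * derivR G Y + Y.2 * derivZ G Y) + a₀ * derivZ G Y = 0 := by
          linear_combination e
        have : Y.1 * derivR G Y + (Y.2 - (-a₀ / γ)) * derivZ G Y =
            γ⁻¹ * (γ * (Y.1 * derivR G Y + Y.2 * derivZ G Y) + a₀ * derivZ G Y) := by
          field_simp
          ring
        rw [this, h', mul_zero]
      -- STEP 1: `U_k ≡ 0`
      have hUk : ∀ Y : ℝ × ℝ, Y.1 ≤ 0 → U k Y = 0 := by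
        have hred : ∀ Y : ℝ × ℝ, Y.1 < 0 → (1 - γ / 2 - k * γ) * U k Y +
            γ * (Y.1 * derivR (U k) Y + Y.2 * derivZ (U k) Y) +
            (-derivZ (Ψ 0) Y * derivR (U k) Y + derivR (Ψ 0) Y * derivZ (U k) Y) = 0 := by
          intro Y hY
          obtain ⟨s₀, hs₀, hsc⟩ := exists_scales hγ hδ Y
          refine order_swirl hs₀ (fun s hs => ?_) k (fun l hl => zU l hl Y) (fun l hl => zΨ l hl Y)
            (fun l hl => vU l hl Y hY.le)
          obtain ⟨h0, h1, h2, h3⟩ := hsc s hs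
          exact (hgen Y hY s h0 h1 h2 h3).1
        by_cases hc : 1 - γ / 2 - k * γ = 0
        · rcases Nat.eq_zero_or_pos k with hk0 | hkpos
          · -- THE RESONANT ORDER `0` AT `γ = 2`: Engine C (print's cut-off argument)
            subst hk0
            refine eq_zero_of_transport_wall_cutoff hO hHO hγ (hU 0) (hΨ 0) (hwall 0)
              (fun Y hY => ?_) (hgrad 0) hp h310
            have e := hred Y hY
            rw [hc, zero_mul, zero_add] at e
            exact e
          · obtain ⟨a₀, hΨ0⟩ := hres hkpos
            refine eq_zero_of_rayTransport hO hHO (hU k) (hray (U k) a₀ hΨ0 fun Y hY => ?_)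
              (decU k)
            have e := hred Y hY
            rw [hc] at e
            exact e
        · exact eq_zero_of_transport_wall_maxPrinciple hO hHO hc (hU k) hW₁ hW₂ hW₁wall hred (decU k)
      have vUk : ∀ l, l ≤ k → ∀ Y : ℝ × ℝ, Y.1 ≤ 0 →
          U l Y = 0 ∧ derivR (U l) Y = 0 ∧ derivZ (U l) Y = 0 := by
        intro l hl Y hY
        rcases hl.lt_or_eq with hlt | heq
        · exact vU l hlt Y hY
        · rw [heq]
          exact ⟨hUk Y hY, derivR_derivZ_eq_zero_of_eq_zero hO hHO (hU k) hUk hY⟩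
      -- STEP 2: `Ω_k ≡ 0`
      have hΩk : ∀ Y : ℝ × ℝ, Y.1 ≤ 0 → Ω k Y = 0 := by
        have hred : ∀ Y : ℝ × ℝ, Y.1 < 0 → (1 - k * γ) * Ω k Y +
            γ * (Y.1 * derivR (Ω k) Y + Y.2 * derivZ (Ω k) Y) +
            (-derivZ (Ψ 0) Y * derivR (Ω k) Y + derivR (Ψ 0) Y * derivZ (Ω k) Y) = 0 := by
          intro Y hY
          obtain ⟨s₀, hs₀, hsc⟩ := exists_scales hγ hδ Y
          refine order_vorticity hs₀ (fun s hs => ?_) k (fun l hl => zU l hl Y)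
            (fun l hl => zΩ l hl Y) (fun l hl => zΨ l hl Y) (fun l hl => vUk l hl Y hY.le)
            (fun l hl => vΩ l hl Y hY.le)
          obtain ⟨h0, h1, h2, h3⟩ := hsc s hs
          exact (hgen Y hY s h0 h1 h2 h3).2.1
        by_cases hc : 1 - k * γ = 0
        · have hkpos : 0 < k := by
            rcases Nat.eq_zero_or_pos k with h0 | h0
            · exfalso; rw [h0] at hc; push_cast at hc; linarith
            · exact h0
          obtain ⟨a₀, hΨ0⟩ := hres hkpos
          refine eq_zero_of_rayTransport hO hHO (hΩ k) (hray (Ω k) a₀ hΨ0 fun Y hY => ?_) (decΩ k)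
          have e := hred Y hY
          rw [hc] at e
          exact e
        · exact eq_zero_of_transport_wall_maxPrinciple hO hHO hc (hΩ k) hW₁ hW₂ hW₁wall hred (decΩ k)
      -- STEP 3: the stream profile `Ψ_k`: constant Laplacian `κ`, then engine B
      have hopen : IsOpen {q : ℝ × ℝ | q.1 < 0} := isOpen_lt continuous_fst continuous_const
      have hstream : ∀ Y : ℝ × ℝ, Y.1 < 0 →
          (-(derivR (derivR (Ψ 0)) Y + derivZ (derivZ (Ψ 0)) Y) - Ω 0 Y = 0) ∧
          ∀ m : ℕ, -(derivR (derivR (Ψ (m + 1))) Y + derivZ (derivZ (Ψ (m + 1))) Y) -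
            Y.1 * (derivR (derivR (Ψ m)) Y + derivZ (derivZ (Ψ m)) Y) - 3 * derivR (Ψ m) Y -
            Ω (m + 1) Y - Y.1 * Ω m Y = 0 := by
        intro Y hY
        obtain ⟨s₀, hs₀, hsc⟩ := exists_scales hγ hδ Y
        exact order_stream hs₀ (fun s hs => by
          obtain ⟨h0, h1, h2, h3⟩ := hsc s hs
          exact (hgen Y hY s h0 h1 h2 h3).2.2) (fun l hl => (zΩ l hl Y).1) (fun l hl => zΨ2 l hl Y)
      -- `κ` and the previous slope
      obtain ⟨κ, aprev, hκa, hprev, hpoisson⟩ : ∃ κ aprev : ℝ, κ = -3 * aprev ∧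
          (∀ k', k = k' + 1 → ∀ Y : ℝ × ℝ, Y.1 ≤ 0 → derivR (Ψ k') Y = aprev) ∧
          ∀ Y : ℝ × ℝ, Y.1 < 0 → derivR (derivR (Ψ k)) Y + derivZ (derivZ (Ψ k)) Y = κ := by
        cases k with
        | zero =>
          refine ⟨0, 0, by ring, fun k' hk' => absurd hk' (by omega), fun Y hY => ?_⟩
          have h := (hstream Y hY).1
          rw [hΩk Y hY.le] at h
          linear_combination -h
        | succ k' =>
          obtain ⟨_, a', b', hΨ', _⟩ := ih k' (Nat.lt_succ_self k')
          refine ⟨-3 * a', a', rfl, fun k'' hk'' Y hY => ?_, fun Y hY => ?_⟩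
          · have : k'' = k' := by omega
            subst this
            exact (hΨ' Y hY).2.1
          · have h := (hstream Y hY).2 k'
            -- `ΔΨ_{k'} = 0` on the open half-plane: its partials are locally constant there
            have hRR : derivR (derivR (Ψ k')) Y = 0 := by
              have hev : derivR (Ψ k') =ᶠ[𝓝 Y] fun _ => a' := by
                filter_upwards [hopen.mem_nhds hY] with q hq
                exact (hΨ' q (le_of_lt hq)).2.1
              rw [derivR_congr_nhds hev, derivR_const]
            have hZZ : derivZ (derivZ (Ψ k')) Y = 0 := by
              have hev : derivZ (Ψ k') =ᶠ[𝓝 Y] fun _ => (0 : ℝ) := by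
                filter_upwards [hopen.mem_nhds hY] with q hq
                exact (hΨ' q (le_of_lt hq)).2.2
              rw [derivZ_congr_nhds hev, derivZ_const]
            rw [hRR, hZZ, (hΨ' Y hY.le).2.1, hΩk Y hY.le, hΩl k' (Nat.lt_succ_self k') Y hY.le] at h
            linear_combination -h
      obtain ⟨hκ0, a, b, hΨk⟩ := stream_affine_of_wall_of_sublinearGradient hO hHO (hΨ k) (hwall k)
        hpoisson (hgrad k)
      have haprev : ∀ k', k = k' + 1 → aprev = 0 := by
        intro k' hk'
        have h3 : -3 * aprev = 0 := by rw [← hκa]; exact hκ0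
        linarith
      -- packaging order `k + 1`
      intro l hl
      by_cases hlk : l < k
      · obtain ⟨hUΩ, a₁, b₁, hΨ₁, himp⟩ := ih l hlk
        refine ⟨hUΩ, a₁, b₁, hΨ₁, fun hl1 => ?_⟩
        by_cases hl2 : l + 1 < k
        · exact himp hl2
        · have hkl : k = l + 1 := by omega
          have e1 := (hΨ₁ (0, 0) le_rfl).2.1
          have e2 := hprev l hkl (0, 0) le_rfl
          rw [← e1, e2]
          exact haprev l hkl
      · have hlk' : l = k := by omega
        subst hlk'
        exact ⟨fun Y hY => ⟨hUk Y hY, hΩk Y hY⟩, a, b, hΨk, fun h => absurd h (lt_irrefl _)⟩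
  -- CONSEQUENCES for the profiles
  have prof : ∀ k, ∃ b : ℝ, ∀ Y : ℝ × ℝ, Y.1 ≤ 0 →
      U k Y = 0 ∧ Ω k Y = 0 ∧ Ψ k Y = b ∧ derivR (Ψ k) Y = 0 ∧ derivZ (Ψ k) Y = 0 := by
    intro k
    obtain ⟨hUΩ, a, b, hΨk, himp⟩ := main (k + 2) k (by omega)
    have ha : a = 0 := himp (by omega)
    refine ⟨b, fun Y hY => ⟨(hUΩ Y hY).1, (hUΩ Y hY).2, ?_, ?_, (hΨk Y hY).2.2⟩⟩
    · rw [(hΨk Y hY).1, ha]; ring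
    · rw [(hΨk Y hY).2.1, ha]
  refine ⟨prof, fun t ht q hq1 hq2 hq3 => ?_⟩
  -- CONSEQUENCES for the fields on the region
  choose b hb using prof
  have hτ : 0 < T - t := sub_pos.2 ht.2
  have hsp : 0 < (T - t) ^ γ := Real.rpow_pos_of_pos hτ γ
  have hYneg : ∀ q' : ℝ × ℝ, q'.1 < 1 → ((q'.1 - 1) / (T - t) ^ γ, q'.2 / (T - t) ^ γ).1 ≤ 0 :=
    fun q' hq' => by simp only; exact div_nonpos_of_nonpos_of_nonneg (by linarith) hsp.le
  have hreg : ∀ᶠ q' : ℝ × ℝ in 𝓝 q, 1 - δ < q'.1 ∧ q'.1 < 1 ∧ |q'.2| < δ := by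
    have ho : IsOpen {q' : ℝ × ℝ | 1 - δ < q'.1 ∧ q'.1 < 1 ∧ |q'.2| < δ} :=
      (isOpen_lt continuous_const continuous_fst).inter
        ((isOpen_lt continuous_fst continuous_const).inter
          (isOpen_lt (continuous_abs.comp continuous_snd) continuous_const))
    exact ho.mem_nhds ⟨hq1, hq2, hq3⟩
  have hψconst : ψ₁ t =ᶠ[𝓝 q] fun _ =>
      (T - t) ^ (-1 + 2 * γ) * ∑ k ∈ Finset.range N, ((T - t) ^ γ) ^ k * b k := by
    filter_upwards [hreg] with q' hq'
    rw [hψ t ht q' hq'.1 hq'.2.1 hq'.2.2]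
    congr 1
    refine Finset.sum_congr rfl fun k _ => ?_
    rw [((hb k) _ (hYneg q' hq'.2.1)).2.2.1]
  refine ⟨?_, ?_, ?_, ?_⟩
  · rw [hu t ht q hq1 hq2 hq3]
    have : ∑ k ∈ Finset.range N, ((T - t) ^ γ) ^ k *
        U k ((q.1 - 1) / (T - t) ^ γ, q.2 / (T - t) ^ γ) = 0 :=
      Finset.sum_eq_zero fun k _ => by rw [((hb k) _ (hYneg q hq2)).1, mul_zero]
    rw [this, mul_zero]
  · rw [hω t ht q hq1 hq2 hq3]
    have : ∑ k ∈ Finset.range N, ((T - t) ^ γ) ^ k *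
        Ω k ((q.1 - 1) / (T - t) ^ γ, q.2 / (T - t) ^ γ) = 0 :=
      Finset.sum_eq_zero fun k _ => by rw [((hb k) _ (hYneg q hq2)).2.1, mul_zero]
    rw [this, mul_zero]
  · rw [derivR_congr_nhds hψconst, derivR_const]
  · rw [derivZ_congr_nhds hψconst, derivZ_const]

/-- **Chae–Tsai 2015, Theorem 2 on `𝒞_{δ,T}`, finite order, every `γ > 0`, with print's
hypothesis (3.10) for the leading swirl profile assumed outright** (for a given even `p`):
the corollary of `chaeTsai2015_seriesAnsatz_trivial_of_integralDecay` in the printed form of the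
hypothesis set (still weaker than print's, which asks (3.10) of `U_k^p + Ω_k^p`, `k ≤ 1/γ`).
[cite: ChaeTsai2015, §3 Theorem 2 (arXiv p. 5–6)] -/
theorem chaeTsai2015_seriesAnsatz_trivial' (hγ : 0 < γ) (hδ : 0 < δ)
    (hS : Ioo (T - δ) T ⊆ S) (hO : IsOpen O) (hHO : {Y : ℝ × ℝ | Y.1 ≤ 0} ⊆ O)
    (hU : ∀ k, ContDiffOn ℝ 1 (U k) O) (hΩ : ∀ k, ContDiffOn ℝ 1 (Ω k) O)
    (hΨ : ∀ k, ContDiffOn ℝ 2 (Ψ k) O)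
    (hN : ∀ k, N ≤ k → U k = 0 ∧ Ω k = 0 ∧ Ψ k = 0)
    (hE : ∀ t ∈ Ioo (T - δ) T, ∀ q : ℝ × ℝ, 1 - δ < q.1 → q.1 < 1 → |q.2| < δ →
      GeneralizedAxisymNS S 3 0 u₁ ω₁ ψ₁ t q)
    (hu : ∀ t ∈ Ioo (T - δ) T, ∀ q : ℝ × ℝ, 1 - δ < q.1 → q.1 < 1 → |q.2| < δ →
      u₁ t q = (T - t) ^ (-1 + γ / 2) * ∑ k ∈ Finset.range N,
        ((T - t) ^ γ) ^ k * U k ((q.1 - 1) / (T - t) ^ γ, q.2 / (T - t) ^ γ))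
    (hω : ∀ t ∈ Ioo (T - δ) T, ∀ q : ℝ × ℝ, 1 - δ < q.1 → q.1 < 1 → |q.2| < δ →
      ω₁ t q = (T - t)⁻¹ * ∑ k ∈ Finset.range N,
        ((T - t) ^ γ) ^ k * Ω k ((q.1 - 1) / (T - t) ^ γ, q.2 / (T - t) ^ γ))
    (hψ : ∀ t ∈ Ioo (T - δ) T, ∀ q : ℝ × ℝ, 1 - δ < q.1 → q.1 < 1 → |q.2| < δ →
      ψ₁ t q = (T - t) ^ (-1 + 2 * γ) * ∑ k ∈ Finset.range N,
        ((T - t) ^ γ) ^ k * Ψ k ((q.1 - 1) / (T - t) ^ γ, q.2 / (T - t) ^ γ))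
    (hdecay : ∀ k, ∀ ε : ℝ, 0 < ε → ∃ M : ℝ, ∀ Y : ℝ × ℝ, Y.1 ≤ 0 → M ≤ ‖Y‖ →
      |U k Y| + |Ω k Y| < ε)
    (hgrad : ∀ k, ∀ ε : ℝ, 0 < ε → ∃ M : ℝ, ∀ Y : ℝ × ℝ, Y.1 ≤ 0 → M ≤ ‖Y‖ →
      |derivR (Ψ k) Y| + |derivZ (Ψ k) Y| ≤ ε * ‖Y‖)
    (hwall : ∀ k (Z : ℝ), derivZ (Ψ k) (0, Z) = 0)
    {p : ℕ} (hp : Even p)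
    (h310 : Tendsto (fun ρ : ℝ =>
      ∫ Y in {Y : ℝ × ℝ | Y.1 ≤ 0 ∧ ρ < ‖Y‖ ∧ ‖Y‖ < 2 * ρ}, U 0 Y ^ p) atTop (𝓝 0)) :
    (∀ k, ∃ b : ℝ, ∀ Y : ℝ × ℝ, Y.1 ≤ 0 →
      U k Y = 0 ∧ Ω k Y = 0 ∧ Ψ k Y = b ∧ derivR (Ψ k) Y = 0 ∧ derivZ (Ψ k) Y = 0) ∧
    (∀ t ∈ Ioo (T - δ) T, ∀ q : ℝ × ℝ, 1 - δ < q.1 → q.1 < 1 → |q.2| < δ →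
      u₁ t q = 0 ∧ ω₁ t q = 0 ∧ derivR (ψ₁ t) q = 0 ∧ derivZ (ψ₁ t) q = 0) :=
  chaeTsai2015_seriesAnsatz_trivial_of_integralDecay hγ hδ hS hO hHO hU hΩ hΨ hN hE hu hω hψ
    hdecay hgrad hwall fun _ => ⟨p, hp, h310⟩

end Main2

end LuoHouSeries

end Literature.Analysis.FluidPDE

end
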